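import Literature.NumberTheory.BeurlingPrimes.DeletedPrimesMoebius
import Literature.NumberTheory.BeurlingPrimes.PerronShift
import Literature.NumberTheory.BeurlingPrimes.BeurlingPerronFormula
import Literature.NumberTheory.BeurlingPrimes.HyperbolaLemma
import Literature.NumberTheory.BeurlingPrimes.IntegerContinuation
import Literature.NumberTheory.BeurlingPrimes.FreeIntegersContinuation
import HarnessLib

/-!
# BDR §5 estimates for the deleted primes under RH: `M_𝒮(x) ≪ x^{α/2+ε}`, `N'(x) = c₀x + O(x^{2α/(α+2)+ε})`,
# `I(β) ≠ 0`, and the pole of `ζ_{α,β}` at `β = 2α/(α+2)`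

Topic `Literature/NumberTheory/BeurlingPrimes`, grouping namespace `PrimeWeight`. Everything in this file is
PROVED (no named facts). Throughout, `S = 𝒮 ⊆ ℙ` carries the adjusted estimate `Adjusted S α A`
(`DeletedPrimesLogZeta.lean`; produced by `RandomPrimeSubset.lean`), `1/2 < α < 1`, and RH is assumed where stated;
`invZetaS = 1/ζ_𝒮` is the RH continuation of `DeletedPrimesMoebius.lean`.

## Part 1. `M_𝒮(x) = Σ_{n ≤ x} μ_𝒮(n) ≪_ε x^{α/2+ε}` by Perron inversion of the Riesz mean

Broucke–Debruyne–Révész (arXiv:2309.01567), §5 p. 16: "A small adaptation of the Perron inversion argument of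
Section 4 … where … the bounds on the half-plane `Re s > α/2 + ε` … are now `O_ε(|t|^ε)` delivers that
`N_𝒮(x) = ax^α + O_ε(x^{α/2+ε})` … The exact same inversion argument applied to the non-decreasing function
`N_𝒮(x) + M_𝒮(x)` whose Mellin–Stieltjes transform is `ζ_𝒮(s) + 1/ζ_𝒮(s)` then gives … Therefore, we have for
each `ε > 0`, `M_𝒮(x) = Σ_{n ≤ x} μ_𝒮(n) ≪_ε x^{α/2+ε}`."

We obtain the last display directly from the order-one Perron formula for `1/ζ_𝒮` (no monotone sandwich is
needed — a shorter road than the printed one, same analytic input): since the `𝒮`-integers are natural numbers,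
the Riesz mean `M₁(y) = Σ_{n ≤ y} μ_𝒮(n)(y − n)` satisfies `|M_𝒮(x) − (M₁(x+1) − M₁(x))| ≤ 1`, and

* `moebRiesz_eq_integral`: `M₁(y) = (1/2π)∫ y^{1+s} L(μ_𝒮, s)/(s(s+1)) dt` on `Re s = κ > 1` (tree pattern
  `Literature.NumberTheory.LFunctions.rieszMean_vonMangoldt_eq_integral_LSeries`);
* the contour is moved to `Re s = α/2 + ε` across NO poles (tree `perron_integral_eq_residues_add` with `S = ∅`,
  `H = invZetaS` holomorphic on `σ > α/2` under RH) and the shifted integral is `≪ x^{α/2+2ε}`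
  (tree `perron_vertical_norm_le` with `B(t) = C(1+t)^ε`);
* `abs_moebCount_le`: under RH, for every `ε > 0`, `|M_𝒮(x)| ≤ C x^{α/2+ε}` for `x ≥ 1`.

## Part 2. The `𝒮`-free integers: `N'(x) = #{n ≤ x : p | n ⇒ p ∉ 𝒮} = c₀ x + O_ε(x^{2α/(α+2)+ε})`

BDR §5 p. 16: with `1_𝒩 = 1_ℕ ∗ μ_𝒮` and `M_𝒮(x) ≪_ε x^{α/2+ε}`, "Applying Lemma 5.1 [the hyperbola lemma] with
the nonnegative functions `h(l) = μ_𝒮(l) + 1_{𝒩_𝒮}(l)` and `h(l) = 1_{𝒩_𝒮}(l)` gives, after subtracting them from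
one another, `Σ_{nl ≤ x, n ∈ ℕ, l ∈ 𝒩_𝒮} μ_𝒮(l) = x/ζ_𝒮(1) + O_ε(x^{2α/(α+2)+ε})`."

Here the same Dirichlet hyperbola argument is run directly on the signed weight `μ_𝒮` (tree: the exact
hyperbola identity `hypConv_eq` of `HyperbolaLemma.lean`; `1_𝒩 = 1 ∗ μ_𝒮` and `N'(x) = Σ_{m ≤ x} μ_𝒮(m)⌊x/m⌋` are
the tree's `sum_divisors_moebS`, `partialSum_freeInd_eq_sum_floor` of `DeletedPrimesHyperbola.lean`), using Part 1
and, for the sums `Σ_{l ≤ z}|μ_𝒮(l)| ≤ N_𝒮(z)`, the elementary bound `N_𝒮(z) ≪_ε z^{α+ε}` (finite Euler product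
over the primes of `𝒮`):

* `freeCount_eq_hypConv` — `N'(x) = Σ_{d ≤ x} μ_𝒮(d) ⌊x/d⌋` as a hyperbola sum; `smoothCount_le` — `N_𝒮(z) ≤ C z^{α+ε}`;
* `freeDensity S = ∫₁^∞ M_𝒮(t) t^{−2} dt` (`= Σ_d μ_𝒮(d)/d = 1/ζ_𝒮(1)`) and
  `abs_freeCount_sub_le` — under RH, for every `ε > 0`: `|N'(x) − freeDensity·x| ≤ C x^{2α/(α+2)+ε}` (`x ≥ 1`);
* `freeDensity_pos` — `freeDensity S > 0` (the free integers contain the primes outside `𝒮`, which are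
  `≫ x/log x` by Chebyshev, too many for a zero density with power-saving error).

## Part 3. The zeta functions of `ℙ ∖ 𝒮` and of `𝒫_{α,β} = (ℙ ∖ 𝒮) ∪ ℙ^{1/β}`: `I(β) ≠ 0` and the pole at `β`

BDR §5 p. 17: "Note that `β > α/2`, so `ζ_𝒮(s)` cannot vanish at `s = 1` or `s = β` as
`log ζ_𝒮(σ) = log ζ(σ+1−α) + O_ε(1)` for `σ > α/2 + ε`. So, this estimate implies that the integers of the system
`𝒫_{α,β}` are `β`-well-behaved (and not better). … In case `β = 2α/(α+2)` … The integers of the system `𝒩_{α,β}`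
can also not be better than `β`-well-behaved as that would entail that the zeta function
`ζ_{α,β}(s) = ζ(s)ζ(s/β)/ζ_𝒮(s)` is analytic at `s = β`, which is false."

For the Beurling systems `P' = ratPrimes.restrict (keptIdx S)` (primes `ℙ ∖ 𝒮`, integers the `𝒮`-free naturals)
and `delSystem S hT (1/β)` (`= P' ∪ ℙ^{1/β}`, tree `DeletedPrimes.lean`):

* `zeta_keptSystem` — `ζ_{P'}(s) = Σ_{n free} n^{−s} = ζ(s) · invZetaS(s)` (`σ > 1`); `zeta_powers_ratPrimes` —
  `ζ_{ℙ^{r}}(s) = ζ(rs)`; `zeta_delSystem_eq` — `ζ_{P' ∪ ℙ^{1/β}}(s) = ζ(s) invZetaS(s) ζ(s/β)`;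
* `abelConst_freeInd_ne_zero` — the constant `I(β) = lim_R (Σ_{n ≤ R, free} n^{−β} − aR^{1−β}/(1−β))` is the value at
  `β` of Landau's continuation of `ζ_{P'}` (tree `IntegerContinuation.lean`), hence `= ζ(β) · invZetaS(β) ≠ 0`
  (uniqueness of continuation, `IsZetaContinuation.eqOn`; `ζ(β) ≠ 0` from RH for real `β ∈ (0,1) ∖ {1/2}`);
* `not_intErrorLE_delSystem` — `N_{P'∪ℙ^{1/β}}(x) = Ax + O(x^{β−ε})` is impossible: Landau's continuation would
  be analytic at `β`, while `ζ(s) invZetaS(s) ζ(s/β)` has a pole there (`ζ(β) invZetaS(β) ≠ 0`).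

## References
* [BrouckeDebruyneRevesz2023] F. Broucke, G. Debruyne, Sz. Gy. Révész, *Some examples of well-behaved Beurling
  number systems*, arXiv:2309.01567, §5 pp. 16–17, Lemma 5.1; §4 and proof of Theorem 3.2 for the inversion
  argument (read).
* [MontgomeryVaughan2007] H. L. Montgomery, R. C. Vaughan, *Multiplicative Number Theory I*, §5.1 (Riesz means).
-/

noncomputable section

open Complex Set Filter MeasureTheory Finset
open scoped Topology Real

/-! ## Part 1. `M_𝒮(x) ≪ x^{α/2+ε}` -/

namespace Literature.NumberTheory.BeurlingPrimes

namespace PrimeWeight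

open Literature.NumberTheory.LFunctions

/-! ### `M_𝒮` and its Riesz mean -/

/-- **`M_𝒮(x) = Σ_{n ≤ x} μ_𝒮(n)`**. [cite: BrouckeDebruyneRevesz2023, §5 p. 16] -/
def moebCount (S : Set ℕ) (x : ℝ) : ℝ := ∑ n ∈ Finset.Ioc 0 ⌊x⌋₊, (moebS S n : ℝ)

/-- **The Riesz mean `M₁(y) = Σ_{n ≤ y} μ_𝒮(n)(y − n)`** of `μ_𝒮`. [cite: BrouckeDebruyneRevesz2023, §4 ("Perron inversion … of order one")] -/
def moebRiesz (S : Set ℕ) (y : ℝ) : ℝ := ∑ n ∈ Finset.Ioc 0 ⌊y⌋₊, (moebS S n : ℝ) * (y - n)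

/-- **The unit-interval difference**: `|M_𝒮(x) − (M₁(x+1) − M₁(x))| ≤ 1` for `x ≥ 0` (at most one integer lies in
`(x, x+1]`, and `|μ_𝒮| ≤ 1`). [folklore] -/
theorem abs_moebCount_sub_le (S : Set ℕ) {x : ℝ} (hx : 0 ≤ x) :
    |moebCount S x - (moebRiesz S (x + 1) - moebRiesz S x)| ≤ 1 := by
  unfold moebCount moebRiesz
  set N := ⌊x⌋₊ with hN
  have hN1 : ⌊x + 1⌋₊ = N + 1 := by rw [hN]; exact Nat.floor_add_one hx
  rw [hN1, Finset.sum_Ioc_succ_top (Nat.zero_le N)]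
  have hsplit : ∑ n ∈ Finset.Ioc 0 N, (moebS S n : ℝ) * (x + 1 - n) - ∑ n ∈ Finset.Ioc 0 N, (moebS S n : ℝ) * (x - n) =
      ∑ n ∈ Finset.Ioc 0 N, (moebS S n : ℝ) := by
    rw [← Finset.sum_sub_distrib]; exact Finset.sum_congr rfl fun n _ ↦ by ring
  have hkey : ∑ n ∈ Finset.Ioc 0 N, (moebS S n : ℝ) -
      (∑ n ∈ Finset.Ioc 0 N, (moebS S n : ℝ) * (x + 1 - n) + (moebS S (N + 1) : ℝ) * (x + 1 - ((N + 1 : ℕ) : ℝ)) -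
        ∑ n ∈ Finset.Ioc 0 N, (moebS S n : ℝ) * (x - n)) =
      -((moebS S (N + 1) : ℝ) * (x + 1 - ((N + 1 : ℕ) : ℝ))) := by linarith [hsplit]
  rw [hkey, abs_neg, abs_mul]
  have h1 := abs_moebS_le_one S (N + 1)
  have h2 : |x + 1 - ((N + 1 : ℕ) : ℝ)| ≤ 1 := by
    have hfl : (N : ℝ) ≤ x := Nat.floor_le hx
    have hfl' : x < N + 1 := Nat.lt_floor_add_one x
    rw [abs_le]; push_cast; constructor <;> linarith
  calc |(moebS S (N + 1) : ℝ)| * |x + 1 - ((N + 1 : ℕ) : ℝ)| ≤ 1 * 1 :=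
        mul_le_mul h1 h2 (abs_nonneg _) zero_le_one
    _ = 1 := one_mul 1

/-! ### Perron's formula of order one for `L(μ_𝒮, s)` -/

/-- One term: for `y > 0`, `σ > 0`, `n ≥ 1`,
`μ_𝒮(n)(y − n)⁺ = (1/2π) ∫ y^{1+σ+it} μ_𝒮(n) n^{−(σ+it)} dt/((σ+it)(σ+1+it))`. [folklore] -/
theorem moebS_mul_posPart_eq_integral (S : Set ℕ) {y : ℝ} (hy : 0 < y) {σ : ℝ} (hσ : 0 < σ) {n : ℕ} (hn : n ≠ 0) :
    ((((moebS S n : ℝ)) * max (y - n) 0 : ℝ) : ℂ) =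
      (1 / (2 * π) : ℂ) * ∫ t : ℝ, (y : ℂ) ^ (1 + ((σ : ℂ) + t * I)) *
        LSeries.term (fun n ↦ ((moebS S n : ℝ) : ℂ)) ((σ : ℂ) + t * I) n *
          (1 / (((σ : ℂ) + t * I) * ((σ : ℂ) + t * I + 1))) := by
  have hn0 : (0 : ℝ) < n := Nat.cast_pos.2 (Nat.pos_of_ne_zero hn)
  have h := posPart_sub_eq_integral hy hn0 hσ
  rw [ofReal_mul, h, ← mul_assoc, mul_comm ((moebS S n : ℝ) : ℂ), mul_assoc, ← MeasureTheory.integral_const_mul]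
  congr 1
  refine integral_congr_ae (Eventually.of_forall fun t ↦ ?_)
  simp only
  rw [LSeries.term_of_ne_zero hn, cpow_neg, div_eq_mul_inv]
  push_cast
  ring

/-- **Perron's formula of order one for `μ_𝒮`**: for `y > 0` and `σ > 1`,
`M₁(y) = Σ_{n ≤ y} μ_𝒮(n)(y − n) = (1/2π) ∫_{−∞}^{∞} y^{1+s} L(μ_𝒮, s)/(s(s+1)) dt`, `s = σ + it`, the integral
converging absolutely. [cite: BrouckeDebruyneRevesz2023, §4 (Perron inversion of order one)] -/
theorem moebRiesz_eq_integral (S : Set ℕ) {y : ℝ} (hy : 0 < y) {σ : ℝ} (hσ : 1 < σ) :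
    ((moebRiesz S y : ℝ) : ℂ) =
      (1 / (2 * π) : ℂ) * ∫ t : ℝ, (y : ℂ) ^ (1 + ((σ : ℂ) + t * I)) *
        LSeries (fun n ↦ ((moebS S n : ℝ) : ℂ)) ((σ : ℂ) + t * I) * (1 / (((σ : ℂ) + t * I) * ((σ : ℂ) + t * I + 1))) := by
  have hσ0 : 0 < σ := by linarith
  have hy0 : (y : ℂ) ≠ 0 := ofReal_ne_zero.2 hy.ne'
  set K : ℝ → ℂ := fun t ↦ 1 / (((σ : ℂ) + t * I) * ((σ : ℂ) + t * I + 1)) with hK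
  set G : ℕ → ℝ → ℂ := fun n t ↦ (y : ℂ) ^ (1 + ((σ : ℂ) + t * I)) *
    LSeries.term (fun n ↦ ((moebS S n : ℝ) : ℂ)) ((σ : ℂ) + t * I) n with hG
  set F : ℕ → ℝ → ℂ := fun n t ↦ G n t * K t with hF
  have hnormG : ∀ n t, ‖G n t‖ = y ^ (1 + σ) * ‖LSeries.term (fun n ↦ ((moebS S n : ℝ) : ℂ)) σ n‖ := by
    intro n t
    simp only [hG, norm_mul]
    congr 1
    · rw [norm_cpow_eq_rpow_re_of_pos hy]; simp
    · rcases eq_or_ne n 0 with rfl | hn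
      · simp [LSeries.term_zero]
      · rw [LSeries.norm_term_eq, LSeries.norm_term_eq]
        simp [hn]
  have hcontG : ∀ n, Continuous (G n) := by
    intro n
    simp only [hG]
    refine Continuous.mul ?_ ?_
    · refine continuous_iff_continuousAt.2 fun t ↦ ?_
      exact (continuousAt_const_cpow hy0).comp (f := fun t : ℝ ↦ 1 + ((σ : ℂ) + t * I)) (by fun_prop)
    · rcases eq_or_ne n 0 with rfl | hn
      · simp only [LSeries.term_zero]; exact continuous_const
      · simp only [LSeries.term_of_ne_zero hn]
        refine continuous_const.div ?_ fun t ↦ ?_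
        · refine continuous_iff_continuousAt.2 fun t ↦ ?_
          exact (continuousAt_const_cpow (Nat.cast_ne_zero.2 hn)).comp
            (f := fun t : ℝ ↦ ((σ : ℂ) + t * I)) (by fun_prop)
        · exact cpow_ne_zero_iff.2 (Or.inl (Nat.cast_ne_zero.2 hn))
  have hintK : Integrable K := integrable_kernel hσ0
  have hintF : ∀ n, Integrable (F n) := fun n ↦
    hintK.bdd_mul (hcontG n).aestronglyMeasurable (Eventually.of_forall fun t ↦ (hnormG n t).le)
  have hsumF : Summable fun n ↦ ∫ t, ‖F n t‖ := by
    have hS : Summable fun n ↦ ‖LSeries.term (fun n ↦ ((moebS S n : ℝ) : ℂ)) σ n‖ :=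
      (LSeriesSummable_moebS S (s := σ) (by simpa using hσ)).norm
    have := (hS.mul_left (y ^ (1 + σ))).mul_right (∫ t : ℝ, ‖K t‖)
    refine this.congr fun n ↦ ?_
    rw [← integral_const_mul]
    refine integral_congr_ae (Eventually.of_forall fun t ↦ ?_)
    simp only [hF, norm_mul, hnormG n t]
  have hterm : ∀ n : ℕ, ((((moebS S n : ℝ)) * max (y - n) 0 : ℝ) : ℂ) = (1 / (2 * π) : ℂ) * ∫ t, F n t := by
    intro n
    rcases eq_or_ne n 0 with rfl | hn
    · simp [hF, hG, LSeries.term_zero, moebS_zero]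
    · exact moebS_mul_posPart_eq_integral S hy hσ0 hn
  have hlhs : ((moebRiesz S y : ℝ) : ℂ) = ∑' n : ℕ, ((((moebS S n : ℝ)) * max (y - n) 0 : ℝ) : ℂ) := by
    unfold moebRiesz
    have h0 : (0 : ℕ) ∉ Finset.Ioc 0 ⌊y⌋₊ := by simp
    rw [tsum_eq_sum (s := insert 0 (Finset.Ioc 0 ⌊y⌋₊)), Finset.sum_insert h0]
    · simp only [moebS_zero, zero_mul, ofReal_zero, zero_add]
      push_cast
      refine Finset.sum_congr rfl fun n hn ↦ ?_
      rw [Finset.mem_Ioc] at hn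
      have hny : (n : ℝ) ≤ y := (Nat.cast_le.2 hn.2).trans (Nat.floor_le hy.le)
      rw [max_eq_left (by linarith)]
      push_cast; ring
    · intro n hn
      rw [Finset.mem_insert, not_or, Finset.mem_Ioc, not_and_or, not_lt, not_le] at hn
      obtain ⟨hn0, hn'⟩ := hn
      have hn1 : ⌊y⌋₊ < n := by
        rcases hn' with h | h
        · exact absurd h (not_le.2 (Nat.pos_of_ne_zero hn0))
        · exact h
      have hyn : y < n := by
        have := Nat.lt_of_floor_lt hn1
        exact_mod_cast this
      rw [max_eq_right (by linarith)]
      simp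
  rw [hlhs, tsum_congr hterm, tsum_mul_left, integral_tsum_of_summable_integral_norm hintF hsumF]
  congr 1
  refine integral_congr_ae (Eventually.of_forall fun t ↦ ?_)
  simp only [hF, hG, hK]
  rw [LSeries, ← tsum_mul_left, ← tsum_mul_right]

variable {S : Set ℕ} {α A : ℝ}

/-- The absolutely convergent Perron integrand is integrable (`σ > 1`). [folklore] -/
theorem integrable_moebPerron (S : Set ℕ) {y : ℝ} (hy : 0 < y) {σ : ℝ} (hσ : 1 < σ) :
    Integrable fun t : ℝ ↦ (y : ℂ) ^ (1 + ((σ : ℂ) + t * I)) *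
        LSeries (fun n ↦ ((moebS S n : ℝ) : ℂ)) ((σ : ℂ) + t * I) * (1 / (((σ : ℂ) + t * I) * ((σ : ℂ) + t * I + 1))) := by
  have hσ0 : 0 < σ := by linarith
  have hy0 : (y : ℂ) ≠ 0 := ofReal_ne_zero.2 hy.ne'
  set Aσ : ℝ := ∑' n : ℕ, ‖LSeries.term (fun n ↦ ((moebS S n : ℝ) : ℂ)) σ n‖ with hA
  have hS : Summable fun n ↦ ‖LSeries.term (fun n ↦ ((moebS S n : ℝ) : ℂ)) σ n‖ :=
    (LSeriesSummable_moebS S (s := σ) (by simpa using hσ)).norm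
  -- `‖L(σ+it)‖ ≤ Aσ` and `L` is continuous in `t`
  have hLnorm : ∀ t : ℝ, ‖LSeries (fun n ↦ ((moebS S n : ℝ) : ℂ)) ((σ : ℂ) + t * I)‖ ≤ Aσ := by
    intro t
    have h1 : Summable fun n ↦ ‖LSeries.term (fun n ↦ ((moebS S n : ℝ) : ℂ)) ((σ : ℂ) + t * I) n‖ :=
      (LSeriesSummable_moebS S (s := (σ : ℂ) + t * I) (by simpa using hσ)).norm
    refine (norm_tsum_le_tsum_norm h1).trans (le_of_eq (tsum_congr fun n ↦ ?_))
    rw [LSeries.norm_term_eq, LSeries.norm_term_eq]; simp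
  have hLcont : Continuous fun t : ℝ ↦ LSeries (fun n ↦ ((moebS S n : ℝ) : ℂ)) ((σ : ℂ) + t * I) := by
    have hS' : Summable fun n ↦ ‖LSeries.term (fun n ↦ ((moebS S n : ℝ) : ℂ)) σ n‖ := hS
    refine continuous_tsum (fun n ↦ ?_) hS' (fun n t ↦ ?_)
    · rcases eq_or_ne n 0 with rfl | hn
      · simp only [LSeries.term_zero]; exact continuous_const
      · simp only [LSeries.term_of_ne_zero hn]
        refine continuous_const.div ?_ fun t ↦ ?_
        · refine continuous_iff_continuousAt.2 fun t ↦ ?_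
          exact (continuousAt_const_cpow (Nat.cast_ne_zero.2 hn)).comp
            (f := fun t : ℝ ↦ ((σ : ℂ) + t * I)) (by fun_prop)
        · exact cpow_ne_zero_iff.2 (Or.inl (Nat.cast_ne_zero.2 hn))
    · rw [LSeries.norm_term_eq, LSeries.norm_term_eq]; simp
  refine (integrable_kernel hσ0).bdd_mul (c := y ^ (1 + σ) * Aσ) ?_ (Eventually.of_forall fun t ↦ ?_)
  · refine Continuous.aestronglyMeasurable (Continuous.mul ?_ hLcont)
    refine continuous_iff_continuousAt.2 fun t ↦ ?_
    exact (continuousAt_const_cpow hy0).comp (f := fun t : ℝ ↦ 1 + ((σ : ℂ) + t * I)) (by fun_prop)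
  · rw [norm_mul, norm_cpow_eq_rpow_re_of_pos hy]
    have hre : (1 + ((σ : ℂ) + t * I)).re = 1 + σ := by simp
    rw [hre]
    exact mul_le_mul_of_nonneg_left (hLnorm t) (by positivity)

/-- **The differenced Perron integral with the order-one kernel**: for `0 < y₁ ≤ y₂` and `σ > 1`,
`M₁(y₂) − M₁(y₁) = (1/2π) ∫ K(y₁,y₂;σ+it) L(μ_𝒮, σ+it) dt` (`K = perronKernel`).
[cite: BrouckeDebruyneRevesz2023, (3.5)–(3.6)] -/
theorem moebRiesz_sub_eq_integral (S : Set ℕ) {y₁ y₂ : ℝ} (hy₁ : 0 < y₁) (hy₂ : 0 < y₂) {σ : ℝ} (hσ : 1 < σ) :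
    ((moebRiesz S y₂ - moebRiesz S y₁ : ℝ) : ℂ) =
      (1 / (2 * π) : ℂ) * ∫ t : ℝ, perronKernel y₁ y₂ ((σ : ℂ) + t * I) *
        LSeries (fun n ↦ ((moebS S n : ℝ) : ℂ)) ((σ : ℂ) + t * I) := by
  have h₁ := moebRiesz_eq_integral S hy₁ hσ
  have h₂ := moebRiesz_eq_integral S hy₂ hσ
  have hi₁ := integrable_moebPerron S hy₁ hσ
  have hi₂ := integrable_moebPerron S hy₂ hσ
  rw [ofReal_sub, h₁, h₂, ← mul_sub, ← integral_sub hi₂ hi₁]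
  congr 1
  refine integral_congr_ae (Eventually.of_forall fun t ↦ ?_)
  simp only [perronKernel]
  field_simp

/-! ### The shifted line: bounds for `B(t) = C(1 + t)^ε` -/

/-- The majorant `B(t) = C (1 + max t 0)^ε` (monotone on `ℝ`, `= C(1+t)^ε` for `t ≥ 0`). [folklore] -/
def powMaj (C ε : ℝ) (t : ℝ) : ℝ := C * (1 + max t 0) ^ ε

/-- `B` is monotone for `C ≥ 0`, `ε ≥ 0`. [folklore] -/
theorem powMaj_mono {C ε : ℝ} (hC : 0 ≤ C) (hε : 0 ≤ ε) : Monotone (powMaj C ε) := fun a b hab ↦ by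
  unfold powMaj
  refine mul_le_mul_of_nonneg_left (Real.rpow_le_rpow (by positivity) ?_ hε) hC
  exact add_le_add le_rfl (max_le_max hab le_rfl)

/-- `B(|t|) = C(1+|t|)^ε`. [folklore] -/
theorem powMaj_abs (C ε t : ℝ) : powMaj C ε |t| = C * (1 + |t|) ^ ε := by
  unfold powMaj; rw [max_eq_left (abs_nonneg t)]

/-- `B(t)/t² ≤ C 2^ε t^{ε−2}` for `t ≥ 1`, hence `B(t)/t²` is integrable on `(X, ∞)`, `X ≥ 1`, `ε < 1`, with
`∫_X^∞ B(t)/t² dt ≤ C 2^ε X^{ε−1}/(1−ε)`. [folklore] -/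
theorem powMaj_div_sq_bound {C ε : ℝ} (hC : 0 ≤ C) (hε : 0 ≤ ε) (hε1 : ε < 1) {X : ℝ} (hX : 1 ≤ X) :
    IntegrableOn (fun t ↦ powMaj C ε t / t ^ 2) (Ioi X) ∧
      ∫ t in Ioi X, powMaj C ε t / t ^ 2 ≤ C * (2 : ℝ) ^ ε * (X ^ (ε - 1) / (1 - ε)) := by
  have hX0 : 0 < X := by linarith
  have hpt : ∀ t ∈ Ioi X, powMaj C ε t / t ^ 2 ≤ C * (2 : ℝ) ^ ε * t ^ (ε - 2) := by
    intro t ht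
    have ht1 : 1 ≤ t := hX.trans (le_of_lt ht)
    have ht0 : 0 < t := by linarith
    unfold powMaj
    rw [max_eq_left ht0.le]
    have h1 : (1 + t) ^ ε ≤ (2 * t) ^ ε := Real.rpow_le_rpow (by linarith) (by linarith) hε
    rw [Real.mul_rpow (by norm_num) ht0.le] at h1
    have h2 : t ^ (ε - 2) = t ^ ε / t ^ 2 := by
      rw [Real.rpow_sub ht0, Real.rpow_two]
    rw [h2]
    rw [div_le_iff₀ (by positivity), mul_div_assoc', div_mul_cancel₀ _ (by positivity)]
    nlinarith
  have hmeas : AEStronglyMeasurable (fun t ↦ powMaj C ε t / t ^ 2) (volume.restrict (Ioi X)) := by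
    unfold powMaj
    refine (Measurable.aestronglyMeasurable ?_)
    exact ((measurable_const.mul ((measurable_const.add (measurable_id.max measurable_const)).pow_const _)).div
      (measurable_id.pow_const _))
  have hmaj : IntegrableOn (fun t : ℝ ↦ C * (2 : ℝ) ^ ε * t ^ (ε - 2)) (Ioi X) :=
    (integrableOn_Ioi_rpow_of_lt (by linarith : ε - 2 < -1) hX0).const_mul _
  have hint : IntegrableOn (fun t ↦ powMaj C ε t / t ^ 2) (Ioi X) := by
    refine Integrable.mono' hmaj hmeas ?_
    rw [ae_restrict_iff' measurableSet_Ioi]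
    refine Eventually.of_forall fun t ht ↦ ?_
    have ht0 : 0 < t := by linarith [hX.trans (le_of_lt ht)]
    rw [Real.norm_eq_abs, abs_of_nonneg (div_nonneg (by unfold powMaj; positivity) (sq_nonneg t))]
    exact hpt t ht
  refine ⟨hint, ?_⟩
  calc ∫ t in Ioi X, powMaj C ε t / t ^ 2 ≤ ∫ t in Ioi X, C * (2 : ℝ) ^ ε * t ^ (ε - 2) :=
        setIntegral_mono_on hint hmaj measurableSet_Ioi hpt
    _ = C * (2 : ℝ) ^ ε * (X ^ (ε - 1) / (1 - ε)) := by
        rw [MeasureTheory.integral_const_mul, integral_Ioi_rpow_of_lt (by linarith : ε - 2 < -1) hX0]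
        congr 1
        rw [show ε - 2 + 1 = ε - 1 by ring, neg_div, ← div_neg, neg_sub]

/-- On `(0, X]` with `0 < σ ≤ 1`: `B(t)/(σ + t) ≤ (C 2^ε/σ) t^{ε−1}`, so
`∫₀^X B(t)/(σ+t) dt ≤ (C 2^ε/σ) X^ε/ε`. [folklore] -/
theorem powMaj_div_bound {C ε σ : ℝ} (hC : 0 ≤ C) (hε : 0 < ε) (hε1 : ε ≤ 1) (hσ : 0 < σ) (hσ1 : σ ≤ 1)
    {X : ℝ} (hX : 0 < X) :
    ∫ t in Ioc 0 X, powMaj C ε t / (σ + t) ≤ C * (2 : ℝ) ^ ε / σ * (X ^ ε / ε) := by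
  have hpt : ∀ t ∈ Ioc 0 X, powMaj C ε t / (σ + t) ≤ C * (2 : ℝ) ^ ε / σ * t ^ (ε - 1) := by
    intro t ht
    have ht0 : 0 < t := ht.1
    unfold powMaj
    rw [max_eq_left ht0.le]
    -- `σ t^{1−ε} (1+t)^ε ≤ 2^ε (σ + t)`: case `t ≤ 1` and `t ≥ 1`
    rw [div_le_iff₀ (by linarith), show C * (2 : ℝ) ^ ε / σ * t ^ (ε - 1) * (σ + t) =
      C * ((2 : ℝ) ^ ε * t ^ (ε - 1) * (σ + t) / σ) by ring]
    refine mul_le_mul_of_nonneg_left ?_ hC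
    rw [le_div_iff₀ hσ]
    have h2ε : (1 : ℝ) ≤ (2 : ℝ) ^ ε := Real.one_le_rpow (by norm_num) hε.le
    rcases le_or_gt t 1 with ht1 | ht1
    · -- `(1+t)^ε ≤ 2^ε`, `t^{ε−1} ≥ 1`
      have h1 : (1 + t) ^ ε ≤ (2 : ℝ) ^ ε := Real.rpow_le_rpow (by linarith) (by linarith) hε.le
      have h3 : 1 ≤ t ^ (ε - 1) := Real.one_le_rpow_of_pos_of_le_one_of_nonpos ht0 ht1 (by linarith)
      have h4 : 0 ≤ (2 : ℝ) ^ ε * t ^ (ε - 1) * t := by positivity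
      calc (1 + t) ^ ε * σ ≤ (2 : ℝ) ^ ε * 1 * σ := by nlinarith
        _ ≤ (2 : ℝ) ^ ε * t ^ (ε - 1) * σ := by gcongr
        _ ≤ (2 : ℝ) ^ ε * t ^ (ε - 1) * (σ + t) := by nlinarith
    · -- `(1+t)^ε ≤ 2^ε t^ε`, `t^{ε−1} t = t^ε`, `σ t ≤ σ + t`
      have h1 : (1 + t) ^ ε ≤ (2 * t) ^ ε := Real.rpow_le_rpow (by linarith) (by linarith) hε.le
      rw [Real.mul_rpow (by norm_num) ht0.le] at h1
      have h5 : t ^ (ε - 1) * t = t ^ ε := by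
        rw [← Real.rpow_add_one ht0.ne']; ring_nf
      have h6 : 0 ≤ (2 : ℝ) ^ ε * t ^ ε := by positivity
      have hkey : σ * t ≤ σ + t := by nlinarith
      have h7 : (2 : ℝ) ^ ε * t ^ (ε - 1) * (σ + t) * t = (2 : ℝ) ^ ε * t ^ ε * (σ + t) := by
        rw [← h5]; ring
      have h8 : (1 + t) ^ ε * σ * t ≤ (2 : ℝ) ^ ε * t ^ (ε - 1) * (σ + t) * t := by
        rw [h7]
        calc (1 + t) ^ ε * σ * t ≤ (2 : ℝ) ^ ε * t ^ ε * σ * t := by gcongr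
          _ = (2 : ℝ) ^ ε * t ^ ε * (σ * t) := by ring
          _ ≤ (2 : ℝ) ^ ε * t ^ ε * (σ + t) := mul_le_mul_of_nonneg_left hkey h6
      exact le_of_mul_le_mul_right h8 ht0
  have hmaj : IntegrableOn (fun t : ℝ ↦ C * (2 : ℝ) ^ ε / σ * t ^ (ε - 1)) (Ioc 0 X) := by
    have := (intervalIntegral.intervalIntegrable_rpow' (a := 0) (b := X) (by linarith : -1 < ε - 1)).1
    exact this.const_mul _
  have hmeas : AEStronglyMeasurable (fun t ↦ powMaj C ε t / (σ + t)) (volume.restrict (Ioc 0 X)) := by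
    unfold powMaj
    refine (Measurable.aestronglyMeasurable ?_)
    exact ((measurable_const.mul ((measurable_const.add (measurable_id.max measurable_const)).pow_const _)).div
      (measurable_const.add measurable_id))
  have hint : IntegrableOn (fun t ↦ powMaj C ε t / (σ + t)) (Ioc 0 X) := by
    refine Integrable.mono' hmaj hmeas ?_
    rw [ae_restrict_iff' measurableSet_Ioc]
    refine Eventually.of_forall fun t ht ↦ ?_
    rw [Real.norm_eq_abs, abs_of_nonneg (div_nonneg (by unfold powMaj; positivity) (by linarith [ht.1]))]
    exact hpt t ht
  calc ∫ t in Ioc 0 X, powMaj C ε t / (σ + t) ≤ ∫ t in Ioc 0 X, C * (2 : ℝ) ^ ε / σ * t ^ (ε - 1) :=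
        setIntegral_mono_on hint hmaj measurableSet_Ioc hpt
    _ = C * (2 : ℝ) ^ ε / σ * (X ^ ε / ε) := by
        rw [MeasureTheory.integral_const_mul, ← intervalIntegral.integral_of_le hX.le,
          integral_rpow (Or.inl (by linarith : -1 < ε - 1))]
        rw [show ε - 1 + 1 = ε by ring, Real.zero_rpow hε.ne', sub_zero]

/-! ### The bound for `M_𝒮` -/

/-- `B(T)/T² → 0` (`δ < 2`). [folklore] -/
theorem tendsto_powMaj_div_sq {C δ : ℝ} (hC : 0 ≤ C) (hδ : 0 ≤ δ) (hδ2 : δ < 2) :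
    Tendsto (fun T : ℝ ↦ powMaj C δ T / T ^ 2) atTop (𝓝 0) := by
  have hlim : Tendsto (fun T : ℝ ↦ C * (2 : ℝ) ^ δ * T ^ (δ - 2)) atTop (𝓝 0) := by
    have := (tendsto_rpow_neg_atTop (show 0 < 2 - δ by linarith)).const_mul (C * (2 : ℝ) ^ δ)
    rw [mul_zero] at this
    refine this.congr fun T ↦ ?_
    rw [show -(2 - δ) = δ - 2 by ring]
  refine squeeze_zero' ?_ ?_ hlim
  · filter_upwards [eventually_ge_atTop (1 : ℝ)] with T hT
    exact div_nonneg (by unfold powMaj; positivity) (sq_nonneg T)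
  · filter_upwards [eventually_gt_atTop (1 : ℝ)] with T hT
    have ht0 : 0 < T := by linarith
    unfold powMaj
    rw [max_eq_left ht0.le]
    have h1 : (1 + T) ^ δ ≤ (2 * T) ^ δ := Real.rpow_le_rpow (by linarith) (by linarith) hδ
    rw [Real.mul_rpow (by norm_num) ht0.le] at h1
    have h2 : T ^ (δ - 2) = T ^ δ / T ^ 2 := by rw [Real.rpow_sub ht0, Real.rpow_two]
    rw [h2, div_le_iff₀ (by positivity), mul_div_assoc', div_mul_cancel₀ _ (by positivity)]
    nlinarith

namespace Adjusted

/-- `t ↦ invZetaS(σ + it)` is continuous for `σ > α/2` (under RH). [folklore] -/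
theorem continuous_invZetaS_line (h : Adjusted S α A) (hRH : RiemannHypothesis) {σ : ℝ} (hσ : α / 2 < σ) :
    Continuous fun t : ℝ ↦ invZetaS S α ((σ : ℂ) + t * I) :=
  (differentiableOn_invZetaS h hRH).continuousOn.comp_continuous (by fun_prop) fun t ↦ by
    simp only [mem_setOf_eq, add_re, ofReal_re, mul_re, I_re, mul_zero, ofReal_im, I_im, mul_one, sub_self,
      add_zero]
    exact hσ

/-- **The shifted Perron integral for `μ_𝒮`** (contour moved from `Re s = 2` to `Re s = σ₁ = α/2 + δ` across no
poles, then estimated): under RH, for `0 < δ ≤ 1/4` and the constant `C` of `‖invZetaS‖ ≤ C(1+|t|)^δ` on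
`σ ≥ α/2 + δ`, for every `x ≥ 1`,
`|M₁(x+1) − M₁(x)| ≤ (8 C 2^δ (1/(σ₁δ) + 1/(1−δ))/π) · x^{σ₁+δ}`. [cite: BrouckeDebruyneRevesz2023, §5 p. 16] -/
theorem abs_moebRiesz_sub_le (h : Adjusted S α A) (hRH : RiemannHypothesis) {δ : ℝ} (hδ : 0 < δ) (hδ4 : δ ≤ 1 / 4)
    {C : ℝ} (hC0 : 0 < C) (hH : ∀ s : ℂ, α / 2 + δ ≤ s.re → ‖invZetaS S α s‖ ≤ C * (1 + |s.im|) ^ δ)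
    {x : ℝ} (hx : 1 ≤ x) :
    |moebRiesz S (x + 1) - moebRiesz S x| ≤
      (8 * C * (2 : ℝ) ^ δ * (1 / ((α / 2 + δ) * δ) + 1 / (1 - δ)) / π) * x ^ (α / 2 + δ + δ) := by
  have hα := h.pos
  have hα1 := h.lt_one
  set σ₁ : ℝ := α / 2 + δ with hσ₁
  have hσ₁0 : 0 < σ₁ := by rw [hσ₁]; positivity
  have hσ₁1 : σ₁ ≤ 1 := by rw [hσ₁]; linarith
  have hx0 : 0 < x := by linarith
  have hx1 : 0 < x + 1 := by linarith
  set H : ℂ → ℂ := invZetaS S α with hHdef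
  set B : ℝ → ℝ := powMaj C δ with hBdef
  -- the bound `‖H(σ + it)‖ ≤ B |t|` on `σ ≥ σ₁`
  have hGB : ∀ σ : ℝ, σ₁ ≤ σ → ∀ t : ℝ, ‖H ((σ : ℂ) + t * I)‖ ≤ B |t| := by
    intro σ hσ t
    rw [hBdef, powMaj_abs]
    have := hH ((σ : ℂ) + t * I) (by simpa using hσ)
    simpa using this
  have hB0 : 0 ≤ B 0 := by rw [hBdef]; unfold powMaj; positivity
  have hBm : Monotone B := powMaj_mono hC0.le hδ.le
  obtain ⟨hBi, hI2⟩ := powMaj_div_sq_bound hC0.le hδ.le (by linarith) (show (1 : ℝ) ≤ x + 1 by linarith)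
  -- integrability and vertical bounds on the two lines
  have hvert : ∀ σ : ℝ, σ₁ ≤ σ →
      Integrable (fun t : ℝ ↦ perronKernel x (x + 1) ((σ : ℂ) + t * I) * H ((σ : ℂ) + t * I)) ∧
        ∫ t : ℝ, ‖perronKernel x (x + 1) ((σ : ℂ) + t * I) * H ((σ : ℂ) + t * I)‖ ≤
          4 * (x + 1) ^ σ * (∫ t in Ioc 0 (x + 1), B t / (σ + t)) + 4 * (x + 1) ^ (1 + σ) * ∫ t in Ioi (x + 1), B t / t ^ 2 :=
    fun σ hσ ↦ perron_vertical_norm_le (lt_of_lt_of_le hσ₁0 hσ) hx0 (by linarith) le_rfl hx1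
      (h.continuous_invZetaS_line hRH (by rw [hσ₁] at hσ; linarith)).aestronglyMeasurable (hGB σ hσ) hB0 hBm hBi
  -- Perron at `κ = 2`
  have hP := moebRiesz_sub_eq_integral S hx0 hx1 (σ := 2) (by norm_num)
  have hL : ∀ t : ℝ, LSeries (fun n ↦ ((moebS S n : ℝ) : ℂ)) (((2 : ℝ) : ℂ) + t * I) = H (((2 : ℝ) : ℂ) + t * I) := by
    intro t
    rw [hHdef, invZetaS_eq_moebSeries h (by simp), moebSeries_eq_LSeries]
  have hP' : ((moebRiesz S (x + 1) - moebRiesz S x : ℝ) : ℂ) =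
      (1 / (2 * π) : ℂ) * ∫ t : ℝ, perronKernel x (x + 1) (((2 : ℝ) : ℂ) + t * I) * H (((2 : ℝ) : ℂ) + t * I) := by
    rw [hP]; congr 1
    exact integral_congr_ae (Eventually.of_forall fun t ↦ by simp only [hL t])
  -- contour shift to `σ₁` (no poles)
  have hshift := perron_integral_eq_residues_add (H := H) (B := B) (σ₀ := α / 2) (σ₁ := σ₁) (κ := 2) (y₁ := x)
    (y₂ := x + 1) (T₁ := 0) ∅ (fun _ ↦ 0) (by linarith) (by rw [hσ₁]; linarith) (by linarith) hx (by linarith)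
    (by simp) (differentiableOn_invZetaS h hRH)
    (by simpa [polePart] using (hvert 2 (by linarith)).1) (by simpa [polePart] using (hvert σ₁ le_rfl).1)
    (fun T _ u hu ↦ by simpa [polePart] using hGB u hu.1 T) (tendsto_powMaj_div_sq hC0.le hδ.le (by linarith))
  simp only [polePart, Finset.sum_empty, mul_zero, zero_add] at hshift
  -- the shifted integral's bound
  obtain ⟨_, hV⟩ := hvert σ₁ le_rfl
  have hI1 := powMaj_div_bound hC0.le hδ (by linarith) hσ₁0 hσ₁1 hx1
  rw [← hBdef] at hI1
  have hX1 : (x + 1) ^ σ₁ * (x + 1) ^ δ = (x + 1) ^ (σ₁ + δ) := by rw [← Real.rpow_add hx1]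
  have hX2 : (x + 1) ^ (1 + σ₁) * (x + 1) ^ (δ - 1) = (x + 1) ^ (σ₁ + δ) := by
    rw [← Real.rpow_add hx1]; ring_nf
  have hbound : ∫ t : ℝ, ‖perronKernel x (x + 1) ((σ₁ : ℂ) + t * I) * H ((σ₁ : ℂ) + t * I)‖ ≤
      4 * C * (2 : ℝ) ^ δ * (1 / (σ₁ * δ) + 1 / (1 - δ)) * (x + 1) ^ (σ₁ + δ) := by
    refine hV.trans ?_
    have h1 : 4 * (x + 1) ^ σ₁ * (∫ t in Ioc 0 (x + 1), B t / (σ₁ + t)) ≤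
        4 * (x + 1) ^ σ₁ * (C * (2 : ℝ) ^ δ / σ₁ * ((x + 1) ^ δ / δ)) :=
      mul_le_mul_of_nonneg_left hI1 (by positivity)
    have h2 : 4 * (x + 1) ^ (1 + σ₁) * (∫ t in Ioi (x + 1), B t / t ^ 2) ≤
        4 * (x + 1) ^ (1 + σ₁) * (C * (2 : ℝ) ^ δ * ((x + 1) ^ (δ - 1) / (1 - δ))) :=
      mul_le_mul_of_nonneg_left hI2 (by positivity)
    have hδ1 : 0 < 1 - δ := by linarith
    have e1 : 4 * (x + 1) ^ σ₁ * (C * (2 : ℝ) ^ δ / σ₁ * ((x + 1) ^ δ / δ)) =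
        4 * C * (2 : ℝ) ^ δ / (σ₁ * δ) * (x + 1) ^ (σ₁ + δ) := by
      rw [← hX1]; field_simp
    have e2 : 4 * (x + 1) ^ (1 + σ₁) * (C * (2 : ℝ) ^ δ * ((x + 1) ^ (δ - 1) / (1 - δ))) =
        4 * C * (2 : ℝ) ^ δ / (1 - δ) * (x + 1) ^ (σ₁ + δ) := by
      rw [← hX2]; field_simp
    calc _ ≤ 4 * (x + 1) ^ σ₁ * (C * (2 : ℝ) ^ δ / σ₁ * ((x + 1) ^ δ / δ)) +
          4 * (x + 1) ^ (1 + σ₁) * (C * (2 : ℝ) ^ δ * ((x + 1) ^ (δ - 1) / (1 - δ))) := add_le_add h1 h2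
      _ = 4 * C * (2 : ℝ) ^ δ * (1 / (σ₁ * δ) + 1 / (1 - δ)) * (x + 1) ^ (σ₁ + δ) := by
          rw [e1, e2]; ring
  -- `(x+1)^{σ₁+δ} ≤ 4 x^{σ₁+δ}`
  have hgrow : (x + 1) ^ (σ₁ + δ) ≤ 4 * x ^ (σ₁ + δ) := by
    have he : σ₁ + δ ≤ 2 := by linarith
    have he0 : 0 ≤ σ₁ + δ := by linarith
    calc (x + 1) ^ (σ₁ + δ) ≤ (2 * x) ^ (σ₁ + δ) := Real.rpow_le_rpow hx1.le (by linarith) he0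
      _ = (2 : ℝ) ^ (σ₁ + δ) * x ^ (σ₁ + δ) := Real.mul_rpow (by norm_num) hx0.le
      _ ≤ 4 * x ^ (σ₁ + δ) := by
          refine mul_le_mul_of_nonneg_right ?_ (Real.rpow_nonneg hx0.le _)
          calc (2 : ℝ) ^ (σ₁ + δ) ≤ (2 : ℝ) ^ (2 : ℝ) := Real.rpow_le_rpow_of_exponent_le (by norm_num) he
            _ = 4 := by norm_num
  -- conclusion
  have hnorm : |moebRiesz S (x + 1) - moebRiesz S x| =
      ‖(1 / (2 * π) : ℂ) * ∫ t : ℝ, perronKernel x (x + 1) ((σ₁ : ℂ) + t * I) * H ((σ₁ : ℂ) + t * I)‖ := by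
    rw [← hshift, ← hP', Complex.norm_real, Real.norm_eq_abs]
  rw [hnorm, norm_mul]
  have hπ : ‖(1 / (2 * π) : ℂ)‖ = 1 / (2 * π) := by
    rw [show (1 / (2 * π) : ℂ) = ((1 / (2 * π) : ℝ) : ℂ) by push_cast; ring, Complex.norm_real, Real.norm_eq_abs,
      abs_of_pos (by positivity)]
  rw [hπ]
  have hK0 : 0 ≤ 4 * C * (2 : ℝ) ^ δ * (1 / (σ₁ * δ) + 1 / (1 - δ)) := by
    have : 0 < 1 - δ := by linarith
    positivity
  calc 1 / (2 * π) * ‖∫ t : ℝ, perronKernel x (x + 1) ((σ₁ : ℂ) + t * I) * H ((σ₁ : ℂ) + t * I)‖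
      ≤ 1 / (2 * π) * (4 * C * (2 : ℝ) ^ δ * (1 / (σ₁ * δ) + 1 / (1 - δ)) * (x + 1) ^ (σ₁ + δ)) :=
        mul_le_mul_of_nonneg_left ((norm_integral_le_integral_norm _).trans hbound) (by positivity)
    _ ≤ 1 / (2 * π) * (4 * C * (2 : ℝ) ^ δ * (1 / (σ₁ * δ) + 1 / (1 - δ)) * (4 * x ^ (σ₁ + δ))) :=
        mul_le_mul_of_nonneg_left (mul_le_mul_of_nonneg_left hgrow hK0) (by positivity)
    _ = (8 * C * (2 : ℝ) ^ δ * (1 / ((α / 2 + δ) * δ) + 1 / (1 - δ)) / π) * x ^ (α / 2 + δ + δ) := by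
        rw [hσ₁]; field_simp; ring

/-- **`M_𝒮(x) ≪_ε x^{α/2+ε}` under RH** (BDR §5: "`M_𝒮(x) = Σ_{n ≤ x} μ_𝒮(n) ≪_ε x^{α/2+ε}`"): for every `ε > 0`
there is `C` with `|M_𝒮(x)| ≤ C x^{α/2 + ε}` for all `x ≥ 1`. [cite: BrouckeDebruyneRevesz2023, §5 p. 16] -/
theorem abs_moebCount_le (h : Adjusted S α A) (hRH : RiemannHypothesis) {ε : ℝ} (hε : 0 < ε) :
    ∃ C : ℝ, ∀ x : ℝ, 1 ≤ x → |moebCount S x| ≤ C * x ^ (α / 2 + ε) := by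
  have hα := h.pos
  set δ : ℝ := min (ε / 2) (1 / 4) with hδ
  have hδ0 : 0 < δ := by rw [hδ]; exact lt_min (by linarith) (by norm_num)
  have hδε : δ + δ ≤ ε := by have := min_le_left (ε / 2) (1 / 4); rw [← hδ] at this; linarith
  have hδ4 : δ ≤ 1 / 4 := min_le_right _ _
  obtain ⟨C, hC0, hH⟩ := norm_invZetaS_le h hRH hδ0 (by linarith : δ ≤ 1)
  set K : ℝ := 8 * C * (2 : ℝ) ^ δ * (1 / ((α / 2 + δ) * δ) + 1 / (1 - δ)) / π with hK
  have hK0 : 0 ≤ K := by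
    rw [hK]
    have : 0 < 1 - δ := by linarith
    positivity
  refine ⟨1 + K, fun x hx ↦ ?_⟩
  have hx0 : 0 < x := by linarith
  have h1 := abs_moebCount_sub_le S hx0.le
  have h2 := h.abs_moebRiesz_sub_le hRH hδ0 hδ4 hC0 hH hx
  rw [← hK] at h2
  have h3 : x ^ (α / 2 + δ + δ) ≤ x ^ (α / 2 + ε) := Real.rpow_le_rpow_of_exponent_le hx (by linarith)
  have h4 : 1 ≤ x ^ (α / 2 + ε) := Real.one_le_rpow hx (by positivity)
  have h5 : |moebCount S x| ≤ 1 + |moebRiesz S (x + 1) - moebRiesz S x| := by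
    have := abs_sub_abs_le_abs_sub (moebCount S x) (moebRiesz S (x + 1) - moebRiesz S x)
    linarith
  calc |moebCount S x| ≤ 1 + K * x ^ (α / 2 + δ + δ) := by linarith
    _ ≤ 1 * x ^ (α / 2 + ε) + K * x ^ (α / 2 + ε) := by
        refine add_le_add (by linarith) (mul_le_mul_of_nonneg_left h3 hK0)
    _ = (1 + K) * x ^ (α / 2 + ε) := by ring

end Adjusted

end PrimeWeight

end Literature.NumberTheory.BeurlingPrimes

/-! ## Part 2. The `𝒮`-free integers -/

namespace Literature.NumberTheory.BeurlingPrimes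

namespace PrimeWeight

/-! ### The count of free integers as a hyperbola sum -/

/-- `partialSum (moebS S) = M_𝒮` (the two normalisations of the summatory function of `μ_𝒮`). [folklore] -/
theorem partialSum_moebS (S : Set ℕ) (x : ℝ) : partialSum (moebS S) x = moebCount S x := by
  unfold partialSum moebCount
  rw [← Finset.sum_Ioc_add_eq_sum_Icc (Nat.zero_le _)]
  simp [moebS_zero]

/-- For `d ≥ 1` and `x ≥ 0`: `Σ_{m ≤ ⌊x⌋} [d·m ≤ x] posInd(m) = ⌊x/d⌋`. [folklore] -/
theorem sum_ite_posInd_eq_floor (S : Set ℕ) {x : ℝ} (hx : 0 ≤ x) {d : ℕ} (hd : 0 < d) :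
    ∑ m ∈ Finset.Icc 0 ⌊x⌋₊, (if (d : ℝ) * (m : ℝ) ^ (1 : ℝ) ≤ x then moebS S d * posInd m else 0) =
      moebS S d * (⌊x / d⌋₊ : ℝ) := by
  have hd' : (0 : ℝ) < d := by exact_mod_cast hd
  have hpt : ∀ m ∈ Finset.Icc 0 ⌊x⌋₊, (if (d : ℝ) * (m : ℝ) ^ (1 : ℝ) ≤ x then moebS S d * posInd m else 0) =
      moebS S d * (if 1 ≤ m ∧ m ≤ ⌊x / d⌋₊ then 1 else 0) := by
    intro m _
    simp only [Real.rpow_one]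
    rcases Nat.eq_zero_or_pos m with rfl | hm
    · simp [posInd]
    · rw [posInd_of_ne_zero hm.ne']
      have hiff : (d : ℝ) * m ≤ x ↔ m ≤ ⌊x / d⌋₊ := by
        rw [Nat.le_floor_iff (div_nonneg hx hd'.le), le_div_iff₀' hd']
      by_cases hc : (d : ℝ) * m ≤ x
      · rw [if_pos hc, if_pos ⟨hm, hiff.mp hc⟩]
      · rw [if_neg hc, if_neg (fun h ↦ hc (hiff.mpr h.2)), mul_zero]
  rw [Finset.sum_congr rfl hpt, ← Finset.mul_sum]
  congr 1
  rw [Finset.sum_boole]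
  have hK : ⌊x / d⌋₊ ≤ ⌊x⌋₊ := Nat.floor_le_floor (div_le_self hx (by exact_mod_cast hd))
  have hfil : (Finset.Icc 0 ⌊x⌋₊).filter (fun m ↦ 1 ≤ m ∧ m ≤ ⌊x / d⌋₊) = Finset.Icc 1 ⌊x / d⌋₊ := by
    ext m; simp only [Finset.mem_filter, Finset.mem_Icc]; omega
  rw [hfil]; simp

/-- `N'(x)` is the hyperbola sum `hypConv (moebS S) posInd 1 x` of `HyperbolaLemma.lean` (`x ≥ 0`). [cite: BrouckeDebruyneRevesz2023, §5 p. 16] -/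
theorem freeCount_eq_hypConv (S : Set ℕ) {x : ℝ} (hx : 0 ≤ x) : partialSum (freeInd S) x = hypConv (moebS S) posInd 1 x := by
  rw [partialSum_freeInd_eq_sum_floor S x]
  unfold hypConv
  refine Finset.sum_congr rfl fun d _ ↦ ?_
  rcases Nat.eq_zero_or_pos d with rfl | hd0
  · simp [moebS_zero]
  · exact (sum_ite_posInd_eq_floor S hx hd0).symm

variable {S : Set ℕ} {α A : ℝ}

/-! ### `N_𝒮(z) ≪ z^{α+ε}`: the smooth numbers are sparse -/

/-- `|μ_𝒮(n)| ≤ 1_{𝒩_𝒮}(n)` (tree: `moebS`, `smoothInd`). [folklore] -/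
theorem abs_moebS_le_smoothInd (S : Set ℕ) (n : ℕ) : |moebS S n| ≤ smoothInd S n := by
  classical
  unfold moebS smoothInd
  rcases eq_or_ne n 0 with rfl | hn
  · simp
  by_cases h : IsSmooth S n
  · rw [if_pos h, if_pos ⟨hn, h⟩]
    exact_mod_cast ArithmeticFunction.abs_moebius_le_one
  · rw [if_neg h, if_neg (fun h' ↦ h h'.2)]; simp

/-- `smoothInd ≥ 0` (tree: `smoothInd_mem_Icc`). [folklore] -/
theorem smoothInd_nonneg (S : Set ℕ) (n : ℕ) : 0 ≤ smoothInd S n := (smoothInd_mem_Icc S n).1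

/-- **`N_𝒮(z) = Σ_{n ≤ z} 1_{𝒩_𝒮}(n) ≤ C z^{a}` for every `a > α`** (`z ≥ 1`): `N_𝒮(z) ≤ z^a Σ_{n ≤ z, smooth} n^{−a}`
and the finite Euler product `Σ_{n smooth} n^{−a} ≤ Π_{p ∈ 𝒮}(1 − p^{−a})^{−1} ≤ exp(K Σ_{p ∈ 𝒮} p^{−a}) < ∞`.
[cite: BrouckeDebruyneRevesz2023, §5 p. 16 ("`N_𝒮(x) = ax^α + O_ε(x^{α/2+ε})`", of which only the order is used)] -/
theorem Adjusted.smoothCount_le (h : Adjusted S α A) {a : ℝ} (ha : α < a) :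
    ∃ C : ℝ, 0 ≤ C ∧ ∀ z : ℝ, 1 ≤ z → partialSum (smoothInd S) z ≤ C * z ^ a := by
  classical
  have hα := h.pos
  have ha0 : 0 < a := by linarith
  -- the completely multiplicative weight `f(n) = 1_{𝒩_𝒮}(n) n^{−a}`
  set f : ℕ → ℝ := fun n ↦ smoothInd S n * (n : ℝ) ^ (-a) with hf
  have hf0 : ∀ n, 0 ≤ f n := fun n ↦ mul_nonneg (smoothInd_nonneg S n) (Real.rpow_nonneg (Nat.cast_nonneg n) _)
  have hf1 : f 1 = 1 := by simp [hf]
  have hsmul : ∀ m n : ℕ, smoothInd S (m * n) = smoothInd S m * smoothInd S n := by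
    intro m n
    unfold smoothInd
    rcases Nat.eq_zero_or_pos m with rfl | hm
    · simp
    rcases Nat.eq_zero_or_pos n with rfl | hn
    · simp
    by_cases h1 : IsSmooth S m <;> by_cases h2 : IsSmooth S n <;>
      simp [h1, h2, isSmooth_mul_iff hm.ne' hn.ne', hm.ne', hn.ne', Nat.mul_ne_zero hm.ne' hn.ne']
  have hfmul : ∀ {m n : ℕ}, m.Coprime n → f (m * n) = f m * f n := by
    intro m n _
    simp only [hf]
    rw [hsmul, Nat.cast_mul, Real.mul_rpow (Nat.cast_nonneg m) (Nat.cast_nonneg n)]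
    ring
  -- prime powers: `f(p^e) = (1_S(p) p^{−a})^e`
  have hfpow : ∀ {p : ℕ}, p.Prime → ∀ e : ℕ, f (p ^ e) = (indSet S p * (p : ℝ) ^ (-a)) ^ e := by
    intro p hp e
    induction e with
    | zero => simp [hf1]
    | succ e ih =>
      rw [pow_succ, pow_succ, ← ih]
      simp only [hf]
      rw [hsmul, Nat.cast_mul, Real.mul_rpow (by positivity) (Nat.cast_nonneg p)]
      have hsp : smoothInd S p = indSet S p := by
        unfold smoothInd indSet
        have : IsSmooth S p ↔ p ∈ S := by simpa using isSmooth_prime_pow_iff (S := S) hp one_ne_zero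
        by_cases hpS : p ∈ S <;> simp [hpS, this, hp.ne_zero]
      rw [hsp]; ring
  have hq : ∀ {p : ℕ}, p.Prime → 0 ≤ indSet S p * (p : ℝ) ^ (-a) ∧ indSet S p * (p : ℝ) ^ (-a) ≤ (2 : ℝ) ^ (-a) := by
    intro p hp
    have h1 := indSet_mem_Icc S p
    have h2 : 0 ≤ (p : ℝ) ^ (-a) := Real.rpow_nonneg (Nat.cast_nonneg p) _
    have h3 : (p : ℝ) ^ (-a) ≤ (2 : ℝ) ^ (-a) :=
      Real.rpow_le_rpow_of_nonpos (by norm_num) (by exact_mod_cast hp.two_le) (by linarith)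
    exact ⟨mul_nonneg h1.1 h2, by nlinarith [h1.2]⟩
  have h2a : (2 : ℝ) ^ (-a) < 1 := Real.rpow_lt_one_of_one_lt_of_neg (by norm_num) (by linarith)
  have hfsum : ∀ {p : ℕ}, p.Prime → Summable (fun e : ℕ ↦ ‖f (p ^ e)‖) := by
    intro p hp
    refine (summable_geometric_of_lt_one (hq hp).1 (lt_of_le_of_lt (hq hp).2 h2a)).congr fun e ↦ ?_
    rw [hfpow hp, Real.norm_of_nonneg (pow_nonneg (hq hp).1 _)]
  -- the local factors are `≤ exp(K · 1_S(p) p^{−a})`, `K = 1/(1 − 2^{−a})`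
  set g : ℕ → ℝ := fun n ↦ indSet S n * (n : ℝ) ^ (-a) with hg
  set K : ℝ := 1 / (1 - (2 : ℝ) ^ (-a)) with hK
  have hK0 : 0 < K := by rw [hK]; exact one_div_pos.mpr (by linarith)
  have hloc : ∀ {p : ℕ}, p.Prime → ∑' e : ℕ, f (p ^ e) ≤ Real.exp (K * g p) := by
    intro p hp
    show ∑' e : ℕ, f (p ^ e) ≤ Real.exp (K * (indSet S p * (p : ℝ) ^ (-a)))
    obtain ⟨hq0, hq1⟩ := hq hp
    set q : ℝ := indSet S p * (p : ℝ) ^ (-a) with hqdef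
    have hq1' : q < 1 := lt_of_le_of_lt hq1 h2a
    simp_rw [hfpow hp]
    rw [tsum_geometric_of_lt_one hq0 hq1']
    refine (inv_one_sub_le_exp hq1').trans (Real.exp_le_exp.mpr ?_)
    rw [hK, one_div_mul_eq_div]
    exact div_le_div_of_nonneg_left hq0 (by linarith) (by linarith)
  -- the sum over the primes of `S`
  have hT : Summable (fun p : Nat.Primes ↦ g p) := h.summable_indSet_rpow_primes ha
  set T : ℝ := ∑' p : Nat.Primes, g p with hTdef
  refine ⟨Real.exp (K * T), (Real.exp_pos _).le, fun z hz ↦ ?_⟩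
  have hz0 : 0 < z := by linarith
  set N : ℕ := ⌊z⌋₊ + 1 with hN
  -- Euler product over the `N`-smooth numbers
  obtain ⟨_, hprod⟩ := EulerProduct.summable_and_hasSum_smoothNumbers_prod_primesBelow_tsum (f := f) hf1 hfmul hfsum N
  -- `Σ_{1 ≤ n ≤ ⌊z⌋} f n ≤ Π_{p < N} Σ_e f(p^e)`
  have hmem : ∀ n ∈ Finset.Ioc 0 ⌊z⌋₊, n ∈ N.smoothNumbers := by
    intro n hn
    rw [Finset.mem_Ioc] at hn
    rw [Nat.mem_smoothNumbers]
    refine ⟨by omega, fun p hp ↦ ?_⟩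
    have := Nat.le_of_mem_primeFactorsList hp
    omega
  have hsum1 : ∑ n ∈ Finset.Ioc 0 ⌊z⌋₊, f n ≤ ∏ p ∈ N.primesBelow, ∑' e : ℕ, f (p ^ e) := by
    have hs := sum_le_hasSum ((Finset.Ioc 0 ⌊z⌋₊).subtype (· ∈ N.smoothNumbers)) (fun m _ ↦ hf0 m) hprod
    rw [Finset.sum_subtype_eq_sum_filter] at hs
    rwa [Finset.filter_true_of_mem hmem] at hs
  -- `Π_{p < N} Σ_e f(p^e) ≤ exp(K T)`
  have hprod_le : ∏ p ∈ N.primesBelow, ∑' e : ℕ, f (p ^ e) ≤ Real.exp (K * T) := by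
    have h1 : ∏ p ∈ N.primesBelow, ∑' e : ℕ, f (p ^ e) ≤ ∏ p ∈ N.primesBelow, Real.exp (K * g p) :=
      Finset.prod_le_prod (fun p _ ↦ tsum_nonneg fun e ↦ hf0 _)
        (fun p hp ↦ hloc (Nat.prime_of_mem_primesBelow hp))
    refine h1.trans ?_
    rw [← Real.exp_sum, Real.exp_le_exp, ← Finset.mul_sum]
    refine mul_le_mul_of_nonneg_left ?_ hK0.le
    have hg0 : ∀ n : ℕ, 0 ≤ g n := fun n ↦ mul_nonneg (indSet_mem_Icc S n).1 (Real.rpow_nonneg (Nat.cast_nonneg _) _)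
    have hind : Summable ({p : ℕ | p.Prime}.indicator g) := summable_subtype_iff_indicator.mp hT
    have hT' : ∑' p : Nat.Primes, g p = ∑' n, {p : ℕ | p.Prime}.indicator g n := tsum_subtype {p : ℕ | p.Prime} g
    rw [hTdef, hT']
    calc ∑ p ∈ N.primesBelow, g p = ∑ p ∈ N.primesBelow, {p : ℕ | p.Prime}.indicator g p :=
          Finset.sum_congr rfl fun p hp ↦ (Set.indicator_of_mem (Nat.prime_of_mem_primesBelow hp) g).symm
      _ ≤ ∑' n, {p : ℕ | p.Prime}.indicator g n :=
          Summable.sum_le_tsum _ (fun n _ ↦ Set.indicator_nonneg (fun m _ ↦ hg0 m) n) hind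
  -- `N_𝒮(z) ≤ z^a Σ_{n ≤ z} f n`
  have hcount : partialSum (smoothInd S) z ≤ z ^ a * ∑ n ∈ Finset.Ioc 0 ⌊z⌋₊, f n := by
    unfold partialSum
    rw [← Finset.sum_Ioc_add_eq_sum_Icc (Nat.zero_le _)]
    simp only [smoothInd, ne_eq, not_true_eq_false, false_and, ↓reduceIte, add_zero]
    rw [Finset.mul_sum]
    refine Finset.sum_le_sum fun n hn ↦ ?_
    rw [Finset.mem_Ioc] at hn
    have hn0 : (0 : ℝ) < n := by exact_mod_cast hn.1
    have hnz : (n : ℝ) ≤ z := le_trans (by exact_mod_cast hn.2) (Nat.floor_le hz0.le)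
    simp only [hf]
    -- `smoothInd n ≤ smoothInd n · (z/n)^a`
    have hr : 1 ≤ z ^ a * (n : ℝ) ^ (-a) := by
      rw [Real.rpow_neg hn0.le, ← div_eq_mul_inv, ← Real.div_rpow hz0.le hn0.le]
      exact Real.one_le_rpow ((one_le_div hn0).mpr hnz) ha0.le
    have hsn := smoothInd_nonneg S n
    calc (if ¬n = 0 ∧ IsSmooth S n then (1 : ℝ) else 0) = smoothInd S n := rfl
      _ ≤ smoothInd S n * (z ^ a * (n : ℝ) ^ (-a)) := le_mul_of_one_le_right hsn hr
      _ = z ^ a * (smoothInd S n * (n : ℝ) ^ (-a)) := by ring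
  calc partialSum (smoothInd S) z ≤ z ^ a * ∑ n ∈ Finset.Ioc 0 ⌊z⌋₊, f n := hcount
    _ ≤ z ^ a * Real.exp (K * T) := mul_le_mul_of_nonneg_left (hsum1.trans hprod_le) (Real.rpow_nonneg hz0.le _)
    _ = Real.exp (K * T) * z ^ a := mul_comm _ _

/-- `Σ_{n ≤ z} |μ_𝒮(n)| ≤ N_𝒮(z)`. [folklore] -/
theorem sum_abs_moebS_le (S : Set ℕ) (z : ℝ) :
    ∑ n ∈ Finset.Icc 0 ⌊z⌋₊, |moebS S n| ≤ partialSum (smoothInd S) z :=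
  Finset.sum_le_sum fun n _ ↦ abs_moebS_le_smoothInd S n

/-! ### The density and the error term -/

/-- **The density of the `𝒮`-free integers**, `c₀ = ∫₁^∞ M_𝒮(t) t^{−2} dt` (`= Σ_d μ_𝒮(d)/d = 1/ζ_𝒮(1)`; written in
the normal form `l ∫₁^∞ A(t) t^{−l−1} dt`, `l = 1`, of `PowerLawAbel.lean`). [cite: BrouckeDebruyneRevesz2023, §5 p. 16 ("`x/ζ_𝒮(1)`")] -/
def freeDensity (S : Set ℕ) : ℝ := 1 * ∫ t in Ioi 1, partialSum (moebS S) t * t ^ (-(1 : ℝ) - 1)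

/-- `⌊t⌋₊ ≤ 1 · t^1` for `t ≥ 1` (the partial sums of `posInd`). [folklore] -/
theorem partialSum_posInd_le (t : ℝ) (ht : 1 ≤ t) : partialSum posInd t ≤ 1 * t ^ (1 : ℝ) := by
  rw [partialSum_posInd, one_mul, Real.rpow_one]; exact Nat.floor_le (by linarith)

/-- **The hyperbola estimate for the free integers** (BDR §5, the display "`Σ_{nl ≤ x} μ_𝒮(l) = x/ζ_𝒮(1) +
O_ε(x^{2α/(α+2)+ε})`"): under RH, for every `ε > 0` there is `C` with `|N'(x) − c₀ x| ≤ C x^{2α/(α+2)+ε}` for all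
`x ≥ 1`. Proof: hyperbola identity with `y = x^{1/(1+α/2)}`, `M_𝒮(u) ≪ u^{α/2+ε₁}`, `Σ_{l≤z}|μ_𝒮(l)| ≤ N_𝒮(z) ≪
z^{α+ε₁}`, and the tail `Σ_{d ≤ y} μ_𝒮(d)/d = c₀ + O(y^{α/2+ε₁−1})` (`PowerLawAbel.abs_tail_sub_le`).
[cite: BrouckeDebruyneRevesz2023, §5 p. 16] -/
theorem Adjusted.abs_freeCount_sub_le (h : Adjusted S α A) (hRH : RiemannHypothesis) {ε : ℝ} (hε : 0 < ε) :
    ∃ C : ℝ, ∀ x : ℝ, 1 ≤ x → |partialSum (freeInd S) x - freeDensity S * x| ≤ C * x ^ (2 * α / (α + 2) + ε) := by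
  have hα := h.pos
  have hα1 := h.lt_one
  -- parameters
  set ε₁ : ℝ := min ε (1 / 4) with hε₁
  have hε₁0 : 0 < ε₁ := by rw [hε₁]; exact lt_min hε (by norm_num)
  have hε₁ε : ε₁ ≤ ε := min_le_left _ _
  have hε₁4 : ε₁ ≤ 1 / 4 := min_le_right _ _
  obtain ⟨CM, hCM⟩ := h.abs_moebCount_le hRH hε₁0
  obtain ⟨Csm, hCsm0, hCsm⟩ := h.smoothCount_le (show α < α + ε₁ by linarith)
  set δ : ℝ := α / 2 + ε₁ with hδ
  set a : ℝ := α + ε₁ with ha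
  have hδ0 : 0 < δ := by rw [hδ]; positivity
  have hδ1 : δ < 1 := by rw [hδ]; linarith
  have ha0 : 0 < a := by rw [ha]; positivity
  set D : ℝ := 1 + α / 2 with hD
  have hD0 : 0 < D := by rw [hD]; positivity
  have hD1 : 1 ≤ D := by rw [hD]; linarith
  have haD : a + 1 - δ = D := by rw [ha, hδ, hD]; ring
  set η : ℝ := 1 / D with hη
  set θ₁ : ℝ := a / D with hθ
  have hη0 : 0 < η := by rw [hη]; positivity
  have hη1 : η ≤ 1 := by rw [hη, div_le_one hD0]; exact hD1
  have hθε : θ₁ ≤ 2 * α / (α + 2) + ε := by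
    have h1 : θ₁ = 2 * α / (α + 2) + 2 * ε₁ / (α + 2) := by rw [hθ, ha, hD]; field_simp; ring
    have h2 : 2 * ε₁ / (α + 2) ≤ ε₁ := by
      rw [div_le_iff₀ (by linarith)]; nlinarith
    linarith
  have hCM0 : 0 ≤ CM := by
    have := hCM 1 le_rfl
    rw [Real.one_rpow, mul_one] at this
    exact (abs_nonneg _).trans this
  -- partial-sum hypotheses
  have hMps : ∀ t, 1 ≤ t → |partialSum (moebS S) t - 0 * t ^ ((δ + 1) / 2)| ≤ CM * t ^ δ := by
    intro t ht; rw [zero_mul, sub_zero, partialSum_moebS]; exact hCM t ht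
  have hMabs : ∀ t, 1 ≤ t → |partialSum (moebS S) t| ≤ CM * t ^ δ := by
    intro t ht; rw [partialSum_moebS]; exact hCM t ht
  set K : ℝ := Csm + CM * (2 + 2 / (1 - δ)) with hK
  refine ⟨K, fun x hx ↦ ?_⟩
  have hx0 : 0 < x := by linarith
  -- the hyperbola parameter `y = x^η ∈ [1, x]`
  set y : ℝ := x ^ η with hy
  have hy1 : 1 ≤ y := Real.one_le_rpow hx hη0.le
  have hy0 : 0 < y := by linarith
  have hyx : y ≤ x := by
    rw [hy]; nth_rewrite 2 [← Real.rpow_one x]; exact Real.rpow_le_rpow_of_exponent_le hx hη1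
  have hxy1 : 1 ≤ x / y := (one_le_div hy0).mpr hyx
  -- exponent bookkeeping: `y^a = x^θ₁`, `x · y^{δ−1} = x^θ₁`
  have hya : y ^ a = x ^ θ₁ := by
    rw [hy, ← Real.rpow_mul hx0.le]; congr 1; rw [hη, hθ]; field_simp
  have hxyd : x * y ^ (δ - 1) = x ^ θ₁ := by
    rw [hy, ← Real.rpow_mul hx0.le]
    nth_rewrite 1 [← Real.rpow_one x]
    rw [← Real.rpow_add hx0]
    congr 1
    rw [hη, hθ]; field_simp; linarith [haD]
  have hxθ : x ^ θ₁ ≤ x ^ (2 * α / (α + 2) + ε) := Real.rpow_le_rpow_of_exponent_le hx hθε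
  have hxθ0 : 0 ≤ x ^ θ₁ := Real.rpow_nonneg hx0.le _
  -- the hyperbola identity
  have hid := hypConv_eq (moebS S) posInd 1 (moebS_zero S) posInd_zero le_rfl hy1 hyx
  rw [← freeCount_eq_hypConv S hx0.le] at hid
  simp only [inv_one, Real.rpow_one, partialSum_posInd] at hid
  -- term A: `Σ_{n ≤ y} a(n) ⌊x/n⌋ = x Σ a(n)/n − R₁`
  have hA1 : ∑ n ∈ Finset.Icc 0 ⌊y⌋₊, moebS S n * (⌊x / n⌋₊ : ℝ) =
      x * ∑ n ∈ Finset.Icc 0 ⌊y⌋₊, moebS S n * (n : ℝ) ^ (-(1 : ℝ)) -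
        ∑ n ∈ Finset.Icc 0 ⌊y⌋₊, moebS S n * (x / n - (⌊x / n⌋₊ : ℝ)) := by
    rw [Finset.mul_sum, ← Finset.sum_sub_distrib]
    refine Finset.sum_congr rfl fun n _ ↦ ?_
    rw [Real.rpow_neg_one, ← div_eq_mul_inv]
    ring
  have hR₁ : |∑ n ∈ Finset.Icc 0 ⌊y⌋₊, moebS S n * (x / n - (⌊x / n⌋₊ : ℝ))| ≤ Csm * y ^ a := by
    refine (Finset.abs_sum_le_sum_abs _ _).trans ?_
    have h1 : ∑ n ∈ Finset.Icc 0 ⌊y⌋₊, |moebS S n * (x / n - (⌊x / n⌋₊ : ℝ))| ≤ ∑ n ∈ Finset.Icc 0 ⌊y⌋₊, |moebS S n| := by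
      refine Finset.sum_le_sum fun n _ ↦ ?_
      rw [abs_mul]
      refine mul_le_of_le_one_right (abs_nonneg _) ?_
      have hfl : (⌊x / n⌋₊ : ℝ) ≤ x / n := Nat.floor_le (div_nonneg hx0.le (Nat.cast_nonneg n))
      have hfl' : x / n < ⌊x / n⌋₊ + 1 := Nat.lt_floor_add_one _
      rw [abs_le]; constructor <;> linarith
    exact h1.trans ((sum_abs_moebS_le S y).trans (hCsm y hy1))
  have htail := abs_tail_sub_le (moebS S) (moebS_zero S) (b := 0) (ρ := (δ + 1) / 2) (τ := δ) (l := 1) (B := CM)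
    hδ0.le (by linarith) (by linarith) hMps hy1
  simp only [zero_mul, zero_div, sub_zero] at htail
  have hA2 : |x * ∑ n ∈ Finset.Icc 0 ⌊y⌋₊, moebS S n * (n : ℝ) ^ (-(1 : ℝ)) - freeDensity S * x| ≤
      CM * (1 + 1 / (1 - δ)) * (x * y ^ (δ - 1)) := by
    have : x * ∑ n ∈ Finset.Icc 0 ⌊y⌋₊, moebS S n * (n : ℝ) ^ (-(1 : ℝ)) - freeDensity S * x =
        -(x * (freeDensity S - ∑ n ∈ Finset.Icc 0 ⌊y⌋₊, moebS S n * (n : ℝ) ^ (-(1 : ℝ)))) := by ring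
    rw [this, abs_neg, abs_mul, abs_of_pos hx0]
    unfold freeDensity
    calc x * |1 * (∫ t in Ioi 1, partialSum (moebS S) t * t ^ (-(1 : ℝ) - 1)) -
          ∑ n ∈ Finset.Icc 0 ⌊y⌋₊, moebS S n * (n : ℝ) ^ (-(1 : ℝ))|
        ≤ x * (CM * (1 + 1 / (1 - δ)) * y ^ (δ - 1)) := mul_le_mul_of_nonneg_left htail hx0.le
      _ = CM * (1 + 1 / (1 - δ)) * (x * y ^ (δ - 1)) := by ring
  -- term B: `|Σ_{m ≤ x/y} posInd(m) M(x/m)| ≤ (CM/(1−δ)) x y^{δ−1}`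
  have hB : |∑ m ∈ Finset.Icc 0 ⌊x / y⌋₊, posInd m * partialSum (moebS S) (x / m)| ≤
      CM / (1 - δ) * (x * y ^ (δ - 1)) := by
    refine (Finset.abs_sum_le_sum_abs _ _).trans ?_
    have h1 : ∑ m ∈ Finset.Icc 0 ⌊x / y⌋₊, |posInd m * partialSum (moebS S) (x / m)| ≤
        ∑ m ∈ Finset.Icc 0 ⌊x / y⌋₊, CM * x ^ δ * (posInd m * (m : ℝ) ^ (-δ)) := by
      refine Finset.sum_le_sum fun m hm ↦ ?_
      rcases Nat.eq_zero_or_pos m with rfl | hm0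
      · simp
      have hm0' : (0 : ℝ) < m := by exact_mod_cast hm0
      have hmx : (m : ℝ) ≤ x := by
        rw [Finset.mem_Icc] at hm
        exact le_trans (by exact_mod_cast hm.2) ((Nat.floor_le (by positivity)).trans (div_le_self hx0.le hy1))
      have hxm : 1 ≤ x / m := (one_le_div hm0').mpr hmx
      rw [abs_mul, abs_of_nonneg (posInd_nonneg m), posInd_of_ne_zero hm0.ne', one_mul, one_mul]
      refine (hMabs _ hxm).trans (le_of_eq ?_)
      rw [Real.div_rpow hx0.le hm0'.le, Real.rpow_neg hm0'.le]; ring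
    refine h1.trans ?_
    rw [← Finset.mul_sum]
    have h2 := sum_mul_rpow_neg_le posInd posInd_zero posInd_nonneg (ρ := 1) (l := δ) (B := 1) hδ0.le hδ1
      partialSum_posInd_le hxy1
    have h3 : x ^ δ * (x / y) ^ (1 - δ) = x * y ^ (δ - 1) := by
      rw [Real.div_rpow hx0.le hy0.le, mul_div_assoc', ← Real.rpow_add hx0, show δ + (1 - δ) = 1 by ring, Real.rpow_one,
        div_eq_mul_inv, ← Real.rpow_neg hy0.le, neg_sub]
    calc CM * x ^ δ * ∑ m ∈ Finset.Icc 0 ⌊x / y⌋₊, posInd m * (m : ℝ) ^ (-δ)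
        ≤ CM * x ^ δ * (1 * (1 / (1 - δ)) * (x / y) ^ (1 - δ)) := mul_le_mul_of_nonneg_left h2 (by positivity)
      _ = CM / (1 - δ) * (x ^ δ * (x / y) ^ (1 - δ)) := by ring
      _ = CM / (1 - δ) * (x * y ^ (δ - 1)) := by rw [h3]
  -- term C: `|M(y)| ⌊x/y⌋ ≤ CM x y^{δ−1}`
  have hC : |partialSum (moebS S) y * (⌊x / y⌋₊ : ℝ)| ≤ CM * (x * y ^ (δ - 1)) := by
    rw [abs_mul, Nat.abs_cast]
    have hfl : (⌊x / y⌋₊ : ℝ) ≤ x / y := Nat.floor_le (by positivity)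
    have h1 : y ^ δ * (x / y) = x * y ^ (δ - 1) := by
      rw [Real.rpow_sub_one hy0.ne']; field_simp
    calc |partialSum (moebS S) y| * (⌊x / y⌋₊ : ℝ) ≤ CM * y ^ δ * (x / y) :=
          mul_le_mul (hMabs y hy1) hfl (Nat.cast_nonneg _) (by positivity)
      _ = CM * (x * y ^ (δ - 1)) := by rw [mul_assoc, h1]
  -- assemble
  have hmain : |partialSum (freeInd S) x - freeDensity S * x| ≤ Csm * y ^ a + CM * (2 + 2 / (1 - δ)) * (x * y ^ (δ - 1)) := by
    rw [hid, hA1]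
    have e : x * ∑ n ∈ Finset.Icc 0 ⌊y⌋₊, moebS S n * (n : ℝ) ^ (-(1 : ℝ)) -
          ∑ n ∈ Finset.Icc 0 ⌊y⌋₊, moebS S n * (x / n - (⌊x / n⌋₊ : ℝ)) +
          ∑ m ∈ Finset.Icc 0 ⌊x / y⌋₊, posInd m * partialSum (moebS S) (x / m) -
          partialSum (moebS S) y * (⌊x / y⌋₊ : ℝ) - freeDensity S * x =
        (x * ∑ n ∈ Finset.Icc 0 ⌊y⌋₊, moebS S n * (n : ℝ) ^ (-(1 : ℝ)) - freeDensity S * x) -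
          ∑ n ∈ Finset.Icc 0 ⌊y⌋₊, moebS S n * (x / n - (⌊x / n⌋₊ : ℝ)) +
          ∑ m ∈ Finset.Icc 0 ⌊x / y⌋₊, posInd m * partialSum (moebS S) (x / m) -
          partialSum (moebS S) y * (⌊x / y⌋₊ : ℝ) := by ring
    rw [e]
    have hδ' : 0 < 1 - δ := by linarith
    calc _ ≤ |x * ∑ n ∈ Finset.Icc 0 ⌊y⌋₊, moebS S n * (n : ℝ) ^ (-(1 : ℝ)) - freeDensity S * x| +
          |∑ n ∈ Finset.Icc 0 ⌊y⌋₊, moebS S n * (x / n - (⌊x / n⌋₊ : ℝ))| +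
          |∑ m ∈ Finset.Icc 0 ⌊x / y⌋₊, posInd m * partialSum (moebS S) (x / m)| +
          |partialSum (moebS S) y * (⌊x / y⌋₊ : ℝ)| := by
            refine (abs_sub _ _).trans (add_le_add ((abs_add_le _ _).trans (add_le_add (abs_sub _ _) le_rfl)) le_rfl)
      _ ≤ CM * (1 + 1 / (1 - δ)) * (x * y ^ (δ - 1)) + Csm * y ^ a + CM / (1 - δ) * (x * y ^ (δ - 1)) +
          CM * (x * y ^ (δ - 1)) := add_le_add (add_le_add (add_le_add hA2 hR₁) hB) hC
      _ = Csm * y ^ a + CM * (2 + 2 / (1 - δ)) * (x * y ^ (δ - 1)) := by ring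
  rw [hya, hxyd] at hmain
  have hδ'' : 0 < 1 - δ := by linarith
  have hK0 : 0 ≤ K := by rw [hK]; positivity
  calc |partialSum (freeInd S) x - freeDensity S * x| ≤ Csm * x ^ θ₁ + CM * (2 + 2 / (1 - δ)) * x ^ θ₁ := hmain
    _ = K * x ^ θ₁ := by rw [hK]; ring
    _ ≤ K * x ^ (2 * α / (α + 2) + ε) := mul_le_mul_of_nonneg_left hxθ hK0

/-! ### Positivity of the density -/

/-- **The free integers contain the primes outside `𝒮`**: `N'(x) ≥ π(⌊x⌋₊) − π_𝒮(x)` for `x ≥ 0`. [folklore] -/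
theorem card_sub_sCount_le_freeCount (S : Set ℕ) (x : ℝ) :
    (Nat.primeCounting ⌊x⌋₊ : ℝ) - wcount (indSet S) x ≤ partialSum (freeInd S) x := by
  classical
  have h1 : (Nat.primeCounting ⌊x⌋₊ : ℝ) - wcount (indSet S) x = ∑ p ∈ primesUpTo x, freeInd S p := by
    rw [← card_primesUpTo, Finset.card_eq_sum_ones, Nat.cast_sum, wcount, ← Finset.sum_sub_distrib]
    refine Finset.sum_congr rfl fun p hp ↦ ?_
    rw [freeInd_prime S (mem_primesUpTo.mp hp).1]; simp
  rw [h1]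
  unfold partialSum
  refine Finset.sum_le_sum_of_subset_of_nonneg (fun p hp ↦ ?_) fun n _ _ ↦ freeInd_nonneg S n
  rw [primesUpTo, Nat.mem_primesLE] at hp
  exact Finset.mem_Icc.mpr ⟨Nat.zero_le _, hp.1⟩

/-- **`c₀ > 0`**: the density of the `𝒮`-free integers is positive (under RH, via `abs_freeCount_sub_le`): otherwise
`N'(x) ≪ x^{θ₁}` with `θ₁ < 1`, contradicting `N'(x) ≥ π(x) − π_𝒮(x) ≫ x/log x` (Chebyshev).
[cite: BrouckeDebruyneRevesz2023, §5 p. 17 ("`ζ_𝒮(s)` cannot vanish at `s = 1`")] -/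
theorem Adjusted.freeDensity_pos (h : Adjusted S α A) (hRH : RiemannHypothesis) : 0 < freeDensity S := by
  have hα := h.pos
  have hα1 := h.lt_one
  by_contra hle
  push Not at hle
  -- an exponent `θ₁ < 1`
  have h23 : 2 * α / (α + 2) < 1 := by rw [div_lt_one (by linarith)]; linarith
  set ε : ℝ := (1 - 2 * α / (α + 2)) / 2 with hε
  have hε0 : 0 < ε := by rw [hε]; linarith
  set θ₁ : ℝ := 2 * α / (α + 2) + ε with hθ
  have hθ1 : θ₁ < 1 := by rw [hθ, hε]; linarith
  obtain ⟨C, hC⟩ := h.abs_freeCount_sub_le hRH hε0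
  set m : ℝ := max θ₁ α with hm
  have hm1 : m < 1 := max_lt hθ1 hα1
  have hθm : θ₁ ≤ m := le_max_left _ _
  have hαm : α ≤ m := le_max_right _ _
  -- `N'(x) ≤ C x^θ₁ ≤ |C| x^m` and `π_𝒮(x) ≤ C₁ x^α ≤ C₁ x^m`, so `π(⌊x⌋₊) ≤ (|C| + C₁) x^m`
  have hup : ∀ x : ℝ, 1 ≤ x → (Nat.primeCounting ⌊x⌋₊ : ℝ) ≤ (|C| + countConst α A) * x ^ m := by
    intro x hx
    have hx0 : 0 < x := by linarith
    have h1 := hC x hx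
    have h2 := h.sCount_le hx
    have h3 := card_sub_sCount_le_freeCount S x
    have h4 : partialSum (freeInd S) x ≤ C * x ^ θ₁ := by
      have := (abs_le.mp h1).2
      have h5 : freeDensity S * x ≤ 0 := mul_nonpos_of_nonpos_of_nonneg hle hx0.le
      linarith
    have hxθ : x ^ θ₁ ≤ x ^ m := Real.rpow_le_rpow_of_exponent_le hx hθm
    have hxα : x ^ α ≤ x ^ m := Real.rpow_le_rpow_of_exponent_le hx hαm
    have hC1 := h.countConst_pos
    have : C * x ^ θ₁ ≤ |C| * x ^ m := (mul_le_mul_of_nonneg_right (le_abs_self C) (Real.rpow_nonneg hx0.le _)).trans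
      (mul_le_mul_of_nonneg_left hxθ (abs_nonneg C))
    nlinarith
  -- Chebyshev: `π(⌊x⌋₊) ≥ (log 2/2) x/log x` eventually; with `log x ≤ x^{(1−m)/2}·2/(1−m)` this is a contradiction
  have hev := eventually_chebyshev_numerator
  have hlo : ∀ᶠ x : ℝ in atTop, (|C| + countConst α A) * x ^ m * Real.log x < Real.log 2 / 2 * x := by
    have h1m : 0 < 1 - m := by linarith
    have hlog := isLittleO_log_rpow_atTop (show 0 < (1 - m) by linarith)
    have hK : 0 < (|C| + countConst α A) + 1 := by have := h.countConst_pos; positivity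
    have := hlog.def (show 0 < Real.log 2 / 2 / ((|C| + countConst α A) + 1) by positivity)
    filter_upwards [this, eventually_gt_atTop (1 : ℝ)] with x hx hx1
    have hx0 : 0 < x := by linarith
    rw [Real.norm_of_nonneg (Real.log_nonneg hx1.le), Real.norm_of_nonneg (Real.rpow_nonneg hx0.le _)] at hx
    have hxm : 0 < x ^ m := Real.rpow_pos_of_pos hx0 _
    have hsplit : x ^ m * x ^ (1 - m) = x := by rw [← Real.rpow_add hx0]; simp
    have h3 : (|C| + countConst α A) * x ^ m * Real.log x ≤
        (|C| + countConst α A) * x ^ m * (Real.log 2 / 2 / (|C| + countConst α A + 1) * x ^ (1 - m)) :=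
      mul_le_mul_of_nonneg_left hx (by have := h.countConst_pos; positivity)
    have h4 : (|C| + countConst α A) * x ^ m * (Real.log 2 / 2 / (|C| + countConst α A + 1) * x ^ (1 - m)) <
        Real.log 2 / 2 * x := by
      have hl2 : 0 < Real.log 2 := Real.log_pos (by norm_num)
      have key : (|C| + countConst α A) / (|C| + countConst α A + 1) < 1 := (div_lt_one hK).mpr (by linarith)
      have e : (|C| + countConst α A) * x ^ m * (Real.log 2 / 2 / (|C| + countConst α A + 1) * x ^ (1 - m)) =
          ((|C| + countConst α A) / (|C| + countConst α A + 1)) * (Real.log 2 / 2 * x) := by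
        rw [show (|C| + countConst α A) * x ^ m * (Real.log 2 / 2 / (|C| + countConst α A + 1) * x ^ (1 - m)) =
          (|C| + countConst α A) * (Real.log 2 / 2 / (|C| + countConst α A + 1)) * (x ^ m * x ^ (1 - m)) by ring, hsplit]
        field_simp
      rw [e]
      exact mul_lt_of_lt_one_left (by positivity) key
    exact lt_of_le_of_lt h3 h4
  obtain ⟨x, hx⟩ := (hev.and (hlo.and (eventually_ge_atTop (2 : ℝ)))).exists
  obtain ⟨hnum, hsmall, hx2⟩ := hx
  have hx1 : (1 : ℝ) < x := by linarith
  have hlx : 0 < Real.log x := Real.log_pos hx1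
  have hpi := Chebyshev.pi_ge' hx1
  have hpi' : Real.log 2 / 2 * x ≤ (Nat.primeCounting ⌊x⌋₊ : ℝ) * Real.log x := by
    have := le_trans (div_le_div_of_nonneg_right hnum hlx.le) hpi
    rwa [div_le_iff₀ hlx] at this
  have hup' := mul_le_mul_of_nonneg_right (hup x hx1.le) hlx.le
  linarith

end PrimeWeight

end Literature.NumberTheory.BeurlingPrimes

/-! ## Part 3. `ζ_{P'}`, `I(β) ≠ 0`, and the pole at `β` -/

namespace Literature.NumberTheory.BeurlingPrimes

namespace PrimeWeight

open Literature.Barriers.RiemannHypothesis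

variable {S : Set ℕ} {α A : ℝ}

/-! ### The zeta function of the kept primes -/

/-- The primes of `ratPrimes.restrict hT` are a subsequence of the rational primes, so `Σ_j λ_j^{−σ} < ∞` for `σ > 1`.
[folklore] -/
theorem summable_prime_restrict_rpow {T : Set ℕ} (hT : T.Infinite) {σ : ℝ} (hσ : 1 < σ) :
    Summable fun j ↦ (ratPrimes.restrict hT).prime j ^ (-σ) := by
  have h1 : Summable fun n : ℕ ↦ (n : ℝ) ^ (-σ) := Real.summable_nat_rpow.mpr (by linarith)
  have h2 : Summable fun j : ℕ ↦ (ratPrime (Nat.nth (fun i ↦ i ∈ T) j) : ℝ) ^ (-σ) :=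
    h1.comp_injective (ratPrime_injective.comp (Nat.nth_injective (infinite_setOf_mem hT)))
  refine h2.congr fun j ↦ ?_
  simp [BeurlingPrimes.prime_restrict]

/-- The free positive integer of an exponent vector supported in `keptIdx S` is its `encode`. [folklore] -/
theorem freeEquiv_apply_val (q : {k : ℕ →₀ ℕ // (k.support : Set ℕ) ⊆ keptIdx S}) : ((freeEquiv S q).1 : ℕ) = encode q.1 :=
  rfl

/-- **`ζ_{P'}(s) = Σ_{n 𝒮-free} n^{−s}`** for `P' = ratPrimes.restrict (keptIdx S)` (any `s`; both are sums over the
free positive integers, reindexed by `k ↦ ∏ q_j^{k_j}`). [cite: BrouckeDebruyneRevesz2023, §5 p. 16] -/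
theorem zeta_keptSystem_eq_freeSeries (hT : (keptIdx S).Infinite) (s : ℂ) :
    (ratPrimes.restrict hT).zeta s = freeSeries S s := by
  classical
  unfold BeurlingPrimes.zeta freeSeries freeTerm
  -- reindex exponent vectors of `P'` by exponent vectors of `ℙ` supported in `keptIdx S`
  have h1 : ∑' k : ℕ →₀ ℕ, (((ratPrimes.restrict hT).genInt k : ℝ) : ℂ) ^ (-s) =
      ∑' q : {k : ℕ →₀ ℕ // (k.support : Set ℕ) ⊆ keptIdx S}, ((ratPrimes.genInt q.1 : ℝ) : ℂ) ^ (-s) := by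
    rw [← (restrictExpEquiv hT).tsum_eq (fun q ↦ ((ratPrimes.genInt q.1 : ℝ) : ℂ) ^ (-s))]
    refine tsum_congr fun k ↦ ?_
    rw [BeurlingPrimes.genInt_restrict]; rfl
  -- then by free positive integers
  have h2 : ∑' q : {k : ℕ →₀ ℕ // (k.support : Set ℕ) ⊆ keptIdx S}, ((ratPrimes.genInt q.1 : ℝ) : ℂ) ^ (-s) =
      ∑' m : {n : ℕ // n ≠ 0 ∧ IsFree S n}, ((m.1 : ℕ) : ℂ) ^ (-s) := by
    rw [← (freeEquiv S).symm.tsum_eq]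
    refine tsum_congr fun m ↦ ?_
    have hm : encode ((freeEquiv S).symm m).1 = m.1 := by
      rw [← freeEquiv_apply_val, Equiv.apply_symm_apply]
    rw [genInt_ratPrimes, hm]; simp
  rw [h1, h2]
  refine (tsum_subtype {n : ℕ | n ≠ 0 ∧ IsFree S n} (fun n : ℕ ↦ (n : ℂ) ^ (-s))).trans ?_
  refine tsum_congr fun n ↦ ?_
  unfold freeInd
  by_cases hn : n ≠ 0 ∧ IsFree S n
  · rw [Set.indicator_of_mem (show n ∈ {n : ℕ | n ≠ 0 ∧ IsFree S n} from hn), if_pos hn]; simp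
  · rw [Set.indicator_of_notMem (show n ∉ {n : ℕ | n ≠ 0 ∧ IsFree S n} from hn), if_neg hn]; simp

/-- **`ζ_{P'}(s) = ζ(s) · invZetaS(s)`** for `σ > 1` (`P' = ℙ ∖ 𝒮`). [cite: BrouckeDebruyneRevesz2023, §5 p. 17] -/
theorem zeta_keptSystem (h : Adjusted S α A) (hT : (keptIdx S).Infinite) {s : ℂ} (hs : 1 < s.re) :
    (ratPrimes.restrict hT).zeta s = riemannZeta s * invZetaS S α s := by
  rw [zeta_keptSystem_eq_freeSeries hT, freeSeries_eq S hs, invZetaS_eq_moebSeries h hs]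

/-- **`N_{P'}(x) = N'(x)`**: the integers of `P'` are the free positive integers. [cite: BrouckeDebruyneRevesz2023, §5 p. 16] -/
theorem intCount_restrict_keptIdx (hT : (keptIdx S).Infinite) {x : ℝ} (hx : 0 ≤ x) :
    ((ratPrimes.restrict hT).intCount x : ℝ) = partialSum (freeInd S) x := by
  rw [partialSum_freeInd_eq_card S hx, BeurlingPrimes.intCount_restrict]
  congr 1
  refine Nat.card_congr ?_
  refine (Equiv.subtypeSubtypeEquivSubtypeInter (fun k : ℕ →₀ ℕ ↦ (k.support : Set ℕ) ⊆ keptIdx S)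
    (fun k ↦ ratPrimes.genInt k ≤ x)).symm.trans ?_
  refine (Equiv.subtypeEquiv (freeEquiv S) (q := fun m : {n : ℕ // n ≠ 0 ∧ IsFree S n} ↦ ((m.1 : ℕ) : ℝ) ≤ x)
    fun q ↦ ?_).trans (Equiv.subtypeSubtypeEquivSubtypeInter (fun n : ℕ ↦ n ≠ 0 ∧ IsFree S n) (fun n ↦ (n : ℝ) ≤ x))
  have hq : (((freeEquiv S q).1 : ℕ) : ℝ) = ratPrimes.genInt q.1 := by
    rw [genInt_ratPrimes, freeEquiv_apply_val]
  show ratPrimes.genInt q.1 ≤ x ↔ (((freeEquiv S q).1 : ℕ) : ℝ) ≤ x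
  rw [hq]

/-! ### The zeta function of `ℙ^{r}` and of the merged system -/

/-- **`ζ_{ℙ^r}(s) = ζ(rs)`** for `r > 0` and `Re(rs) > 1`. [cite: BrouckeDebruyneRevesz2023, §5 p. 14 ("`N_β(x) = ζ(1/β)x + ζ(β)x^β + …`")] -/
theorem zeta_powers_ratPrimes {r : ℝ} (hr : 0 < r) {s : ℂ} (hs : 1 < (r * s).re) :
    (ratPrimes.powers r hr).zeta s = riemannZeta (r * s) := by
  unfold BeurlingPrimes.zeta
  have hterm : ∀ k : ℕ →₀ ℕ, (((ratPrimes.powers r hr).genInt k : ℝ) : ℂ) ^ (-s) = ((encode k : ℕ) : ℂ) ^ (-(r * s)) := by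
    intro k
    rw [BeurlingPrimes.genInt_powers, genInt_ratPrimes]
    have h0 : (0 : ℝ) < (encode k : ℕ) := by exact_mod_cast Nat.pos_of_ne_zero (encode_ne_zero k)
    rw [ofReal_cpow h0.le, ← cpow_mul]
    · simp only [ofReal_natCast, mul_neg]
    · rw [show Complex.log ((encode k : ℕ) : ℝ) = ((Real.log (encode k : ℕ) : ℝ) : ℂ) by
        rw [ofReal_log h0.le]]
      rw [← ofReal_mul, ofReal_im]; exact neg_lt_zero.mpr Real.pi_pos
    · rw [show Complex.log ((encode k : ℕ) : ℝ) = ((Real.log (encode k : ℕ) : ℝ) : ℂ) by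
        rw [ofReal_log h0.le]]
      rw [← ofReal_mul, ofReal_im]; exact Real.pi_pos.le
  rw [tsum_congr hterm]
  -- reindex by positive integers and use `ζ(w) = Σ_{n ≥ 1} n^{−w}`
  have h1 : ∑' k : ℕ →₀ ℕ, ((encode k : ℕ) : ℂ) ^ (-(r * s)) = ∑' m : {n : ℕ // n ≠ 0}, ((m.1 : ℕ) : ℂ) ^ (-(r * s)) := by
    rw [← encodeEquiv.tsum_eq]; rfl
  rw [h1, zeta_eq_tsum_one_div_nat_add_one_cpow hs]
  refine (tsum_subtype {n : ℕ | n ≠ 0} (fun n : ℕ ↦ (n : ℂ) ^ (-(r * s)))).trans ?_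
  have hsum : Summable fun n : ℕ ↦ ({n : ℕ | n ≠ 0} : Set ℕ).indicator (fun n : ℕ ↦ (n : ℂ) ^ (-(r * s))) n := by
    refine Summable.of_norm_bounded (g := fun n : ℕ ↦ (n : ℝ) ^ (-(r * s).re)) (Real.summable_nat_rpow.mpr (by linarith)) ?_
    intro n
    by_cases hn : n ∈ ({n : ℕ | n ≠ 0} : Set ℕ)
    · rw [Set.indicator_of_mem hn, Complex.norm_natCast_cpow_of_pos (Nat.pos_of_ne_zero hn), neg_re]
    · rw [Set.indicator_of_notMem hn, norm_zero]; exact Real.rpow_nonneg (Nat.cast_nonneg n) _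
  rw [hsum.tsum_eq_zero_add]
  simp only [Set.mem_setOf_eq, ne_eq, not_true_eq_false, not_false_eq_true, Set.indicator_of_notMem, zero_add]
  refine tsum_congr fun n ↦ ?_
  rw [Set.indicator_of_mem (show n + 1 ∈ ({n : ℕ | n ≠ 0} : Set ℕ) from Nat.succ_ne_zero n), one_div, ← cpow_neg]
  push_cast; rfl

/-- **`ζ_{P ∪ Q}(s) = ζ_P(s) ζ_Q(s)`** when both Dirichlet series converge absolutely. [folklore] -/
theorem zeta_merge {P Q : BeurlingPrimes} {s : ℂ} (hP : Summable fun k : ℕ →₀ ℕ ↦ ‖((P.genInt k : ℝ) : ℂ) ^ (-s)‖)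
    (hQ : Summable fun k : ℕ →₀ ℕ ↦ ‖((Q.genInt k : ℝ) : ℂ) ^ (-s)‖) :
    (P.merge Q).zeta s = P.zeta s * Q.zeta s := by
  unfold BeurlingPrimes.zeta
  rw [tsum_mul_tsum_of_summable_norm hP hQ, ← (pairExpEquiv (mergeEquiv P Q)).tsum_eq]
  refine tsum_congr fun kk ↦ ?_
  rw [pairExpEquiv_apply, BeurlingPrimes.genInt_pairToExp (fun n ↦ BeurlingPrimes.prime_merge P Q n), ofReal_mul,
    mul_cpow_ofReal_nonneg (P.genInt_pos kk.1).le (Q.genInt_pos kk.2).le]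

/-- **`ζ_{P' ∪ ℙ^{1/β}}(s) = ζ(s) · invZetaS(s) · ζ(s/β)`** for `σ > 1` (`0 < β ≤ 1`): the zeta function of
`delSystem S hT (1/β)`. [cite: BrouckeDebruyneRevesz2023, §5 p. 17 ("`ζ_{α,β}(s) = ζ(s)ζ(s/β)/ζ_𝒮(s)`")] -/
theorem zeta_delSystem_eq (h : Adjusted S α A) (hT : (keptIdx S).Infinite) {β : ℝ} (hβ0 : 0 < β) (hβ1 : β ≤ 1)
    {s : ℂ} (hs : 1 < s.re) :
    (delSystem S hT β⁻¹ (inv_pos.mpr hβ0)).zeta s = riemannZeta s * invZetaS S α s * riemannZeta (s / β) := by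
  have hs0 : 0 < s.re := by linarith
  have hβs : s.re ≤ β⁻¹ * s.re := le_mul_of_one_le_left hs0.le (one_le_inv_iff₀.mpr ⟨hβ0, hβ1⟩)
  have hrs : 1 < (((β⁻¹ : ℝ) : ℂ) * s).re := by rw [re_ofReal_mul]; linarith
  have e : s / (β : ℂ) = ((β⁻¹ : ℝ) : ℂ) * s := by push_cast; ring
  unfold delSystem
  rw [e, zeta_merge, zeta_keptSystem h hT hs, zeta_powers_ratPrimes (inv_pos.mpr hβ0) hrs]
  · exact (ratPrimes.restrict hT).summable_norm_genInt_cpow hs0 (by simpa using summable_prime_restrict_rpow hT hs)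
  · refine (ratPrimes.powers β⁻¹ (inv_pos.mpr hβ0)).summable_norm_genInt_cpow hs0 ?_
    have h1 : Summable fun n : ℕ ↦ (n : ℝ) ^ (-(β⁻¹ * s.re)) := Real.summable_nat_rpow.mpr (by linarith)
    have h2 : Summable fun j : ℕ ↦ (ratPrime j : ℝ) ^ (-(β⁻¹ * s.re)) := h1.comp_injective ratPrime_injective
    refine h2.congr fun j ↦ ?_
    simp only [BeurlingPrimes.prime_powers, ratPrimes_prime]
    rw [← Real.rpow_mul (Nat.cast_nonneg _)]; ring_nf

/-! ### `I(β) ≠ 0` -/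

/-- Under RH, `ζ(β) ≠ 0` for real `β ∈ (0, 1)`, `β ≠ 1/2`. [folklore] -/
theorem riemannZeta_ne_zero_of_RH_real (hRH : RiemannHypothesis) {β : ℝ} (hβ0 : 0 < β) (hβ1 : β < 1) (hβ : β ≠ 1 / 2) :
    riemannZeta β ≠ 0 := by
  intro h0
  have h := hRH β h0 ?_ ?_
  · simp only [ofReal_re] at h; exact hβ h
  · rintro ⟨n, hn⟩
    have := congrArg Complex.re hn
    simp at this
    have : (0 : ℝ) ≤ n := Nat.cast_nonneg n
    linarith
  · intro h1
    have := congrArg Complex.re h1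
    simp at this
    linarith

/-- The value of Landau's continuation at a real point: `Z(β) = I(β)` where `I = abelConst c a β` of
`PowerLawAbel.lean` and `c = freeInd S` (both are `aβ/(β−1) + β∫₁^∞ (N'(t) − at)t^{−β−1} dt`). [folklore] -/
theorem intZeta_keptSystem_ofReal (hT : (keptIdx S).Infinite) (a : ℝ) {β : ℝ} (hβ1 : β ≠ 1) :
    (ratPrimes.restrict hT).intZeta a β = (abelConst (freeInd S) a β : ℂ) := by
  unfold BeurlingPrimes.intZeta abelConst
  rw [Hilberdink.mellin_errN_eq_setIntegral]
  have hint : ∫ x in Ioi (1 : ℝ), ((((ratPrimes.restrict hT).intCount x : ℝ) - a * x : ℝ) : ℂ) * (x : ℂ) ^ (-(β : ℂ) - 1) =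
      ((∫ t in Ioi (1 : ℝ), (partialSum (freeInd S) t - a * t) * t ^ (-β - 1) : ℝ) : ℂ) := by
    rw [← integral_complex_ofReal]
    refine setIntegral_congr_fun measurableSet_Ioi fun x hx ↦ ?_
    have hx0 : 0 < x := lt_trans one_pos hx
    rw [intCount_restrict_keptIdx hT hx0.le, show (-(β : ℂ) - 1) = ((-β - 1 : ℝ) : ℂ) by push_cast; ring,
      ← ofReal_cpow hx0.le]
    push_cast; ring
  rw [hint]
  have hβ1' : (β : ℂ) - 1 ≠ 0 := by
    intro h; apply hβ1; have := congrArg Complex.re h; simp at this; linarith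
  have hβ1'' : (1 : ℂ) - β ≠ 0 := by
    intro h; apply hβ1; have := congrArg Complex.re h; simp at this; linarith
  push_cast
  field_simp
  ring

/-- **`I(β) ≠ 0`** (BDR: "`I(β) = ζ(β)/ζ_𝒮(β) ≠ 0` … `ζ_𝒮(s)` cannot vanish at `s = β`"): under RH, if
`|N'(y) − ay| ≤ C y^τ` (`y ≥ 1`) with `α/2 ≤ τ < β < 1`, `β ≠ α`, `β ≠ 1/2`, then `abelConst (freeInd S) a β ≠ 0` — it is
the value at `β` of the continuation `ζ(s) invZetaS(s)` of `ζ_{P'}`. [cite: BrouckeDebruyneRevesz2023, §5 p. 17] -/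
theorem abelConst_freeInd_ne_zero (h : Adjusted S α A) (hRH : RiemannHypothesis) (hT : (keptIdx S).Infinite)
    {a β τ C : ℝ} (hτα : α / 2 ≤ τ) (hτβ : τ < β) (hβ0 : 0 < β) (hβ1 : β < 1) (hβα : β ≠ α) (hβh : β ≠ 1 / 2)
    (hN : ∀ y : ℝ, 1 ≤ y → |partialSum (freeInd S) y - a * y| ≤ C * y ^ τ) :
    abelConst (freeInd S) a β ≠ 0 := by
  have hN' : ∀ x : ℝ, 1 ≤ x → |((ratPrimes.restrict hT).intCount x : ℝ) - a * x| ≤ C * x ^ τ := fun x hx ↦ by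
    rw [intCount_restrict_keptIdx hT (by linarith)]; exact hN x hx
  have hτ1 : τ < 1 := by linarith
  -- the two continuations
  have h₁ : (ratPrimes.restrict hT).IsZetaContinuation τ ((ratPrimes.restrict hT).intZeta a) :=
    isZetaContinuation_intZeta hτ1 hN'
  have h₂ : (ratPrimes.restrict hT).IsZetaContinuation τ (fun s ↦ riemannZeta s * invZetaS S α s) := by
    refine ⟨fun s hs ↦ (zeta_keptSystem h hT hs).symm, fun s hs ↦ ?_⟩
    have hs1 : s ≠ 1 := hs.2
    have hsα : α / 2 < s.re := lt_of_le_of_lt hτα hs.1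
    exact ((differentiableAt_riemannZeta hs1).mul ((differentiableOn_invZetaS h hRH).differentiableAt
      ((isOpen_lt continuous_const continuous_re).mem_nhds hsα))).differentiableWithinAt
  have heq := BeurlingPrimes.IsZetaContinuation.eqOn h₁ h₂ (x := (β : ℂ)) ⟨by simpa using hτβ, by
    intro h1; apply (show β ≠ 1 by linarith); have := congrArg Complex.re h1; simpa using this⟩
  rw [intZeta_keptSystem_ofReal hT a (by linarith)] at heq
  intro h0
  rw [h0, ofReal_zero] at heq
  have hne : riemannZeta β * invZetaS S α β ≠ 0 :=
    mul_ne_zero (riemannZeta_ne_zero_of_RH_real hRH hβ0 hβ1 hβh)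
      (invZetaS_ne_zero h hRH (by simp; linarith) (by
        intro h1; apply hβα; have := congrArg Complex.re h1; simpa using this))
  exact hne heq.symm

/-! ### The pole at `β`: `N(x) = Ax + O(x^{β−ε})` is impossible for `P' ∪ ℙ^{1/β}` -/

/-- **The pole of `ζ_{P'∪ℙ^{1/β}}` at `β` excludes `N(x) = Ax + O(x^{β−ε})`** (BDR: "that would entail that the
zeta function `ζ_{α,β}(s) = ζ(s)ζ(s/β)/ζ_𝒮(s)` is analytic at `s = β`, which is false"): under RH, for
`α/2 < β < 1`, `β ≠ α`, `β ≠ 1/2`, every `A` and every `ε > 0`, `¬ IntErrorLE (delSystem S hT β⁻¹) A (β − ε)`.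
[cite: BrouckeDebruyneRevesz2023, §5 p. 17] -/
theorem not_intErrorLE_delSystem (h : Adjusted S α A) (hRH : RiemannHypothesis) (hT : (keptIdx S).Infinite)
    {β : ℝ} (hβα2 : α / 2 < β) (hβ1 : β < 1) (hβα : β ≠ α) (hβh : β ≠ 1 / 2) (A' : ℝ) {ε : ℝ} (hε : 0 < ε) :
    ¬ (delSystem S hT β⁻¹ (inv_pos.mpr (lt_trans (by linarith [h.pos]) hβα2))).IntErrorLE A' (β - ε) := by
  have hα := h.pos
  have hβ0 : 0 < β := lt_trans (by linarith) hβα2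
  set P'' := delSystem S hT β⁻¹ (inv_pos.mpr hβ0) with hP''
  intro hI
  -- shrink `ε` so that `γ = β − ε' > α/2`
  set ε' : ℝ := min ε ((β - α / 2) / 2) with hε'
  have hε'0 : 0 < ε' := lt_min hε (by linarith)
  have hε'ε : ε' ≤ ε := min_le_left _ _
  set γ : ℝ := β - ε' with hγ
  have hγα : α / 2 < γ := by
    have := min_le_right ε ((β - α / 2) / 2); rw [← hε'] at this; rw [hγ]; linarith
  have hγβ : γ < β := by rw [hγ]; linarith
  have hγ1 : γ < 1 := by linarith
  have hI' : P''.IntErrorLE A' γ := BeurlingPrimes.IntErrorLE.of_le _ hI (by rw [hγ]; linarith)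
  obtain ⟨C, hC⟩ := hI'
  -- the two continuations on `{β < re} ∖ {1}`
  have h₁ : P''.IsZetaContinuation β (P''.intZeta A') := (isZetaContinuation_intZeta hγ1 hC).mono hγβ.le
  set Z₂ : ℂ → ℂ := fun s ↦ riemannZeta s * invZetaS S α s * riemannZeta (s / β) with hZ₂
  have h₂ : P''.IsZetaContinuation β Z₂ := by
    refine ⟨fun s hs ↦ (zeta_delSystem_eq h hT hβ0 hβ1.le hs).symm, fun s hs ↦ ?_⟩
    have hs1 : s ≠ 1 := hs.2
    have hsα : α / 2 < s.re := lt_trans hβα2 hs.1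
    have hsβ : s / β ≠ 1 := by
      intro h1
      rw [div_eq_one_iff_eq (by exact_mod_cast hβ0.ne')] at h1
      have := hs.1
      rw [h1, ofReal_re] at this; exact lt_irrefl _ this
    have hd1 := differentiableAt_riemannZeta hs1
    have hd2 := (differentiableOn_invZetaS h hRH).differentiableAt ((isOpen_lt continuous_const continuous_re).mem_nhds hsα)
    have hd3 : DifferentiableAt ℂ (fun s : ℂ ↦ riemannZeta (s / β)) s :=
      (differentiableAt_riemannZeta hsβ).comp s (differentiableAt_id.div_const _)
    exact ((hd1.mul hd2).mul hd3).differentiableWithinAt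
  have heq := BeurlingPrimes.IsZetaContinuation.eqOn h₁ h₂
  -- approach `β` from the right along reals `s_n = β + δ_n`, `δ_n = (1−β)/(n+2)`
  set δ : ℕ → ℝ := fun n ↦ (1 - β) / ((n : ℝ) + 2) with hδ
  have hδ0 : ∀ n, 0 < δ n := fun n ↦ by rw [hδ]; exact div_pos (by linarith) (by positivity)
  have hδ1 : ∀ n, δ n < 1 - β := fun n ↦ by
    show (1 - β) / ((n : ℝ) + 2) < 1 - β
    rw [div_lt_iff₀ (by positivity)]
    nlinarith [mul_pos (show (0 : ℝ) < 1 - β by linarith) (show (0 : ℝ) < (n : ℝ) + 1 by positivity)]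
  have hδlim : Tendsto δ atTop (𝓝 0) := by
    have := (tendsto_one_div_add_atTop_nhds_zero_nat.comp (tendsto_add_atTop_nat 1)).const_mul (1 - β)
    rw [mul_zero] at this
    refine this.congr fun n ↦ ?_
    simp only [hδ, Function.comp_apply]; push_cast; ring
  set sq : ℕ → ℂ := fun n ↦ ((β + δ n : ℝ) : ℂ) with hsq
  have hsq_mem : ∀ n, sq n ∈ {s : ℂ | β < s.re ∧ s ≠ 1} := fun n ↦ by
    refine ⟨by simp [hsq, hδ0 n], fun h1 ↦ ?_⟩
    have := congrArg Complex.re h1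
    simp [hsq] at this
    linarith [hδ1 n]
  have hsq_lim : Tendsto sq atTop (𝓝 (β : ℂ)) := by
    have h1 : Tendsto (fun n ↦ β + δ n) atTop (𝓝 β) := by simpa using hδlim.const_add β
    exact (continuous_ofReal.tendsto β).comp h1
  -- `Z₁ ∘ sq → Z₁ β` (continuity at `β` from the domain `{γ < re} ∖ {1}`)
  have hZ₁cont : Tendsto (fun n ↦ P''.intZeta A' (sq n)) atTop (𝓝 (P''.intZeta A' β)) := by
    have hmem : (β : ℂ) ∈ {s : ℂ | γ < s.re ∧ s ≠ 1} :=
      ⟨by simpa using hγβ, fun h1 ↦ by have := congrArg Complex.re h1; simp at this; linarith⟩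
    have hopen : IsOpen {s : ℂ | γ < s.re ∧ s ≠ 1} := (isOpen_lt continuous_const continuous_re).inter isOpen_ne
    exact (((differentiableOn_intZeta hC).differentiableAt (hopen.mem_nhds hmem)).continuousAt.tendsto).comp hsq_lim
  -- `‖Z₂ ∘ sq‖ → ∞`
  have hZ₂div : Tendsto (fun n ↦ ‖Z₂ (sq n)‖) atTop atTop := by
    have hL : riemannZeta β * invZetaS S α β ≠ 0 :=
      mul_ne_zero (riemannZeta_ne_zero_of_RH_real hRH hβ0 hβ1 hβh)
        (invZetaS_ne_zero h hRH (by simpa using hβα2) (by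
          intro h1; apply hβα; have := congrArg Complex.re h1; simpa using this))
    -- first factor → `‖L‖ > 0`
    have hf1 : Tendsto (fun n ↦ ‖riemannZeta (sq n) * invZetaS S α (sq n)‖) atTop (𝓝 ‖riemannZeta β * invZetaS S α β‖) := by
      refine (Tendsto.norm ?_)
      have hc1 : ContinuousAt riemannZeta (β : ℂ) := (differentiableAt_riemannZeta (by
        intro h1; have := congrArg Complex.re h1; simp at this; linarith)).continuousAt
      have hc2 : ContinuousAt (invZetaS S α) (β : ℂ) := ((differentiableOn_invZetaS h hRH).differentiableAt
        ((isOpen_lt continuous_const continuous_re).mem_nhds (by simpa using hβα2))).continuousAt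
      exact (hc1.tendsto.comp hsq_lim).mul (hc2.tendsto.comp hsq_lim)
    -- second factor: `sq n / β → 1` within `≠ 1`
    have hw : Tendsto (fun n ↦ sq n / β) atTop (𝓝[≠] 1) := by
      refine tendsto_nhdsWithin_of_tendsto_nhds_of_eventually_within _ ?_ (Eventually.of_forall fun n ↦ ?_)
      · have := hsq_lim.div_const (β : ℂ)
        rwa [div_self (by exact_mod_cast hβ0.ne')] at this
      · rw [Set.mem_compl_singleton_iff, Ne, div_eq_one_iff_eq (by exact_mod_cast hβ0.ne')]
        intro h1
        have := congrArg Complex.re h1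
        simp [hsq] at this
        linarith [hδ0 n]
    have hf2 : Tendsto (fun n ↦ ‖riemannZeta (sq n / β)‖) atTop atTop := tendsto_norm_riemannZeta_atTop.comp hw
    have := hf1.pos_mul_atTop (norm_pos_iff.mpr hL) hf2
    refine this.congr fun n ↦ ?_
    simp only [hZ₂, norm_mul]
  -- contradiction: `Z₁ ∘ sq = Z₂ ∘ sq` is both convergent and divergent
  have hsame : ∀ n, P''.intZeta A' (sq n) = Z₂ (sq n) := fun n ↦ heq (hsq_mem n)
  have hconv : Tendsto (fun n ↦ ‖Z₂ (sq n)‖) atTop (𝓝 ‖P''.intZeta A' β‖) := by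
    refine (hZ₁cont.norm).congr fun n ↦ ?_; rw [hsame n]
  exact not_tendsto_atTop_of_tendsto_nhds hconv hZ₂div

end PrimeWeight

end Literature.NumberTheory.BeurlingPrimes
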